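import Literature.Computability.Complexity.SuccinctCircuitBits
import Literature.Computability.Complexity.RecursiveOrbitReturns
import HarnessLib

/-!
# Succinct arithmetic circuits of polynomial depth, II: the bit evaluator as a recursive
# procedure (the machine, its codes, and its space/time certificate)

Sequel of `SuccinctCircuitBits.lean` (`SuccCircuit`, `val`, `bitLang`, §SchoolArith). The bit
language of a succinct circuit is decided by ONE recursive procedure (`RecProc`,
`RecursiveOrbitDeciders.lean`): the activation record of a call "bit `i` of gate `g`" holds the
gate name and thirteen small registers; a SUM gate is scanned column by column (`j = 0 … i`),
each column by sub-calls "bit `j` of child `k`" accumulating the column count, with the carry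
propagated (Knuth's Algorithm A); a PRODUCT gate likewise with the convolution columns
`∑_{a ≤ j} [bit a of x][bit (j−a) of y]` (Algorithm M); a SELECT gate compares its first two
children bit by bit on the `width` low bits and then tail-calls the chosen child; a CONSTANT gate
answers from its bit oracle. Koiran–Perifel obtain the `PSPACE` bound through polynomial-depth
Boolean circuits and the parallel computation thesis; here the recursion is run on the activation-
record stack of `RecProc`, whose depth is the circuit depth and whose records are polynomially short.

* §Registers — a tiny register-expression language `NEx` (registers, constants, `+`, `∸`, `/2`,
  `mod 2`, branching on `=`, `<`, `≤`), `NEx.eval`, and `NEx.code` / `NEx.codeAll`: every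
  expression / table of expressions is `CodeFP` on the register file (`rawE natE`).
* §Program — frames `(g, regs)`, actions (`Act.cont`, `.call`, `.ret`) and their tagged codes
  `actE`; the transition tables (`hdrRegs`, `contRegs`, `postRegs`, `resumeRegs`), the call
  predicate `callNow` with `childIx` / `tgtBit`, and the one-step semantics `stepSem`, `resumeSem`
  — the evaluator as a mathematical function on frames. Register file:
  `[0 pc, 1 i, 2 kind, 3 arity, 4 width, 5 j, 6 ix, 7 col, 8 carry, 9 b, 10 flag, 11 u, 12 ans]`.
* §Codes — `stepSem`, `resumeSem` and the root frame are `CodeFP`; **`evalProc K : RecProc`**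
  (its three `FP` string functions chosen from these), with the bridge lemmas `step_frameE`,
  `resume_frameE`, `init_eq` and the tag computations `actE_*`.
* §BigStep — the big-step rules at frame level (`returns_ret`, `returns_cont`, `returns_call`) and
  **`returns_frame_induct`**: rule induction over `RecProc.Returns` phrased with `stepSem` /
  `resumeSem` (from `Returns.induct_inv`), which the semantic file uses.

The CERTIFICATE (rank = depth of the gate, potential = a per-program-point loop measure, well-
formedness invariant; hence halting within `2^{poly}` steps in polynomial space) and the SEMANTIC
correctness (`bitLang K ∈ PSPACE`) are the next files.

HONEST FRAMING (val-lit, KV20 M1 programme, brick (P2) layer G): generic plumbing; proves nothing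
about `kumarVolk2020_cor_1_3` by itself; `VP ≠ VNP` is NOT proved and nothing here bears on it.

## References

* P. Koiran, S. Perifel, *VPSPACE and a transfer theorem over the reals*, Comput. Complexity 18
  (2009), §3.2, Prop. 1 (proof: coefficient of a gate from those of its children, "+-gate … add";
  "gate a × b … the sum of the cd") [KoiranPerifel2009VPSPACE].
* D. E. Knuth, *TAOCP 2*, §4.3.1, Algorithms A and M [KnuthTAOCP2].
* S. Homer, A. L. Selman, *Computability and Complexity Theory*, Thm. 5.13 (recursive procedures on
  a stack of activation records) [HomerSelman2011].
* S. Arora, B. Barak, *Computational Complexity*, §1.3 (polynomial time: composition, branching)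
  [AroraBarak2009].
-/

noncomputable section

namespace Literature.Computability.Complexity

open _root_.Computability Polynomial CodeFP Brick Finset

namespace SuccCircuit

/-! ### Registers: a tiny expression language, computed on codes -/

/-- Register expressions over a file of natural-number registers: register `k` (default `0`),
constants, sum, truncated difference, halving, parity, and branching on a comparison of two
sub-expressions. [cite: AroraBarak2009, §1.3] -/
inductive NEx : Type
  /-- register `k` (`0` if absent) -/
  | reg (k : ℕ)
  /-- a constant -/
  | cst (n : ℕ)
  /-- sum -/
  | add (a b : NEx)
  /-- truncated difference -/
  | sub (a b : NEx)
  /-- halving `⌊a/2⌋` -/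
  | half (a : NEx)
  /-- parity `a mod 2` -/
  | par (a : NEx)
  /-- `if x = y then a else b` -/
  | iteEq (x y a b : NEx)
  /-- `if x < y then a else b` -/
  | iteLt (x y a b : NEx)
  /-- `if x ≤ y then a else b` -/
  | iteLe (x y a b : NEx)

/-- The value of a register expression on a register file. [cite: AroraBarak2009, §1.3] -/
def NEx.eval (r : List ℕ) : NEx → ℕ
  | .reg k => r.getD k 0
  | .cst n => n
  | .add a b => a.eval r + b.eval r
  | .sub a b => a.eval r - b.eval r
  | .half a => a.eval r / 2
  | .par a => a.eval r % 2
  | .iteEq x y a b => if x.eval r = y.eval r then a.eval r else b.eval r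
  | .iteLt x y a b => if x.eval r < y.eval r then a.eval r else b.eval r
  | .iteLe x y a b => if x.eval r ≤ y.eval r then a.eval r else b.eval r

/-- Code of a register file: raw list of binary numerals. [cite: AroraBarak2009, §0.1] -/
abbrev regsE : List ℕ → List Bool := rawE natE

/-- **Every register expression is computed on codes in polynomial time.** [cite: AroraBarak2009, §1.3 (composition and branching)] -/
theorem NEx.code : ∀ e : NEx, CodeFP regsE natE (fun r => e.eval r)
  | .reg k => ((rawGetOr natE).comp ((CodeFP.id regsE).pair ((const regsE k).pair (const regsE (0 : ℕ))))).congr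
      fun r => rfl
  | .cst n => (const regsE n).congr fun _ => rfl
  | .add a b => (natAdd.comp (a.code.pair b.code)).congr fun _ => rfl
  | .sub a b => (natSub.comp (a.code.pair b.code)).congr fun _ => rfl
  | .half a => (natDiv.comp (a.code.pair (const regsE (2 : ℕ)))).congr fun _ => rfl
  | .par a => (natMod.comp (a.code.pair (const regsE (2 : ℕ)))).congr fun _ => rfl
  | .iteEq x y a b => ((natEq.comp (x.code.pair y.code)).ite a.code b.code).congr fun r => by
      simp only [NEx.eval]; by_cases h : x.eval r = y.eval r <;> simp [h]
  | .iteLt x y a b => ((natLt.comp (x.code.pair y.code)).ite a.code b.code).congr fun r => by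
      simp only [NEx.eval]; by_cases h : x.eval r < y.eval r <;> simp [h]
  | .iteLe x y a b => ((natLe.comp (x.code.pair y.code)).ite a.code b.code).congr fun r => by
      simp only [NEx.eval]; by_cases h : x.eval r ≤ y.eval r <;> simp [h]

/-- A table of expressions evaluated in parallel on the OLD register file. [cite: AroraBarak2009, §1.3] -/
def NEx.evalAll (es : List NEx) (r : List ℕ) : List ℕ := es.map fun e => e.eval r

/-- Tables are computed on codes. [cite: AroraBarak2009, §1.3] -/
theorem NEx.codeAll : ∀ es : List NEx, CodeFP regsE regsE (fun r => NEx.evalAll es r)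
  | [] => (const regsE ([] : List ℕ)).congr fun _ => rfl
  | e :: es => ((rawCons natE).comp (e.code.pair (NEx.codeAll es))).congr fun _ => rfl

/-- The length of a table's result is the table's length. [cite: AroraBarak2009, §1.3] -/
@[simp] theorem NEx.length_evalAll (es : List NEx) (r : List ℕ) : (NEx.evalAll es r).length = es.length :=
  List.length_map _

/-- Reading an entry of a table's result. [cite: AroraBarak2009, §1.3] -/
theorem NEx.getD_evalAll (es : List NEx) (r : List ℕ) (k : ℕ) (e : NEx) (h : es[k]? = some e) :
    (NEx.evalAll es r).getD k 0 = e.eval r := by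
  rw [List.getD_eq_getElem?_getD, NEx.evalAll, List.getElem?_map, h]
  rfl

/-! ### The program -/

/-- Activation records of the evaluator: the gate name and the register file. [cite: HomerSelman2011, Thm. 5.13 (proof, p. 97: activation records)] -/
abbrev Frame : Type := List Bool × List ℕ

/-- Code of an activation record. [cite: AroraBarak2009, §0.1] -/
abbrev frameE : Frame → List Bool := pairE strE regsE

/-- What one step of an activation record does: continue with an updated record, call a callee
record, or return a value. [cite: HomerSelman2011, Thm. 5.13 (proof, p. 97)] -/
inductive Act : Type
  /-- continue with the updated record -/
  | cont (x : Frame)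
  /-- call: push the callee's record -/
  | call (x : Frame)
  /-- return a value -/
  | ret (v : List Bool)

/-- The tagged code of an action, in the format of `RecProc.step` (`00·frame'`, `01·callee`, `1·value`). [cite: HomerSelman2011, Thm. 5.13 (proof, p. 97)] -/
def actE : Act → List Bool
  | .cont x => false :: false :: frameE x
  | .call x => false :: true :: frameE x
  | .ret v => true :: v

/-- The register file of a fresh call "bit `t`": program point `0`, target bit `t`, all else `0`. [cite: KoiranPerifel2009VPSPACE, §3.2, Prop. 1 (proof)] -/
def initRegs (t : ℕ) : List ℕ := [0, t, 0, 0, 0, 0, 0, 0, 0, 0, 0, 0, 0]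

section Tables

open NEx

/-- Register `pc` (program point). [folklore] -/
abbrev rPC : NEx := .reg 0
/-- Register `i` (the bit this call must return). [folklore] -/
abbrev rI : NEx := .reg 1
/-- Register `kind` (kind of the gate, cached). [folklore] -/
abbrev rK : NEx := .reg 2
/-- Register `arity` (cached). [folklore] -/
abbrev rA : NEx := .reg 3
/-- Register `width` (cached). [folklore] -/
abbrev rW : NEx := .reg 4
/-- Register `j` (current column / compared bit). [folklore] -/
abbrev rJ : NEx := .reg 5
/-- Register `ix` (current summand / current term `a` of a convolution column). [folklore] -/
abbrev rX : NEx := .reg 6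
/-- Register `col` (partial column sum). [folklore] -/
abbrev rC : NEx := .reg 7
/-- Register `carry`. [folklore] -/
abbrev rY : NEx := .reg 8
/-- Register `b` (the bit last returned by a callee). [folklore] -/
abbrev rB : NEx := .reg 9
/-- Register `flag` (`1` right after a callee returned, until the post-call update). [folklore] -/
abbrev rF : NEx := .reg 10
/-- Register `u` (a saved bit: first factor's bit / first compared bit). [folklore] -/
abbrev rU : NEx := .reg 11
/-- Register `ans` (the answer bit, at program point `13`). [folklore] -/
abbrev rS : NEx := .reg 12

/-- Program point `1` (dispatch on the kind): to `10` (sum), `20` (product), `30` (select), else `2` (constant). [cite: KoiranPerifel2009VPSPACE, §3.2, Prop. 1 (proof)] -/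
def tbl1 : List NEx :=
  [.iteEq rK (.cst 1) (.cst 10) (.iteEq rK (.cst 2) (.cst 20) (.iteEq rK (.cst 3) (.cst 30) (.cst 2))),
    rI, rK, rA, rW, rJ, rX, rC, rY, rB, rF, rU, rS]

/-- Program point `10` (sum: start): `j, ix, col, carry := 0`, to `11`. [cite: KnuthTAOCP2, §4.3.1, Algorithm A (A1)] -/
def tbl10 : List NEx := [.cst 11, rI, rK, rA, rW, .cst 0, .cst 0, .cst 0, .cst 0, rB, rF, rU, rS]

/-- Program point `11` with `ix ≥ arity` (column complete): to `12`. [cite: KnuthTAOCP2, §4.3.1, Algorithm A (A2)] -/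
def tbl11 : List NEx := [.cst 12, rI, rK, rA, rW, rJ, rX, rC, rY, rB, rF, rU, rS]

/-- Program point `12` (sum: end of column `j`, `T = col + carry`): if `j = i` answer `T mod 2` and go
to `13`, else `carry := ⌊T/2⌋`, `col, ix := 0`, `j := j + 1`, back to `11`. [cite: KnuthTAOCP2, §4.3.1, Algorithm A (A2–A3)] -/
def tbl12 : List NEx :=
  [.iteEq rJ rI (.cst 13) (.cst 11), rI, rK, rA, rW, .iteEq rJ rI rJ (.add rJ (.cst 1)),
    .iteEq rJ rI rX (.cst 0), .iteEq rJ rI rC (.cst 0), .iteEq rJ rI rY (.half (.add rC rY)), rB, rF, rU,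
    .iteEq rJ rI (.par (.add rC rY)) rS]

/-- Program point `20` (product: start): `j, a, col, carry := 0`, to `21`. [cite: KnuthTAOCP2, §4.3.1, Algorithm M (M1)] -/
def tbl20 : List NEx := [.cst 21, rI, rK, rA, rW, .cst 0, .cst 0, .cst 0, .cst 0, rB, rF, rU, rS]

/-- Program point `21` with `a > j` (convolution column complete): to `24`. [cite: KnuthTAOCP2, §4.3.1, Algorithm M] -/
def tbl21 : List NEx := [.cst 24, rI, rK, rA, rW, rJ, rX, rC, rY, rB, rF, rU, rS]

/-- Program point `22` with `u ≠ 1` (first factor's bit `a` is `0`: the term vanishes): `a := a + 1`,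
back to `21`. [cite: KnuthTAOCP2, §4.3.1, Algorithm M (M4: "if uⱼ = 0 …")] -/
def tbl22 : List NEx := [.cst 21, rI, rK, rA, rW, rJ, .add rX (.cst 1), rC, rY, rB, rF, rU, rS]

/-- Program point `24` (product: end of column `j`), as `12` with `21` for `11`. [cite: KnuthTAOCP2, §4.3.1, Algorithm M (M5–M6)] -/
def tbl24 : List NEx :=
  [.iteEq rJ rI (.cst 13) (.cst 21), rI, rK, rA, rW, .iteEq rJ rI rJ (.add rJ (.cst 1)),
    .iteEq rJ rI rX (.cst 0), .iteEq rJ rI rC (.cst 0), .iteEq rJ rI rY (.half (.add rC rY)), rB, rF, rU,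
    .iteEq rJ rI (.par (.add rC rY)) rS]

/-- Program point `30` (select: start): `j := 0`, to `31`. [cite: KoiranPerifel2009VPSPACE, §3.2] -/
def tbl30 : List NEx := [.cst 31, rI, rK, rA, rW, .cst 0, rX, rC, rY, rB, rF, rU, rS]

/-- Program point `31` with `j ≥ width` (all compared bits agree): to `35`. [cite: KoiranPerifel2009VPSPACE, §3.2] -/
def tbl31 : List NEx := [.cst 35, rI, rK, rA, rW, rJ, rX, rC, rY, rB, rF, rU, rS]

/-- **The CONTINUE table** (no pending return, not a call, `pc ∉ {0, 2, 13}`), by program point. [cite: KoiranPerifel2009VPSPACE, §3.2, Prop. 1 (proof)] -/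
def contRegs (r : List ℕ) : List ℕ :=
  if r.getD 0 0 = 1 then evalAll tbl1 r
  else if r.getD 0 0 = 10 then evalAll tbl10 r
  else if r.getD 0 0 = 11 then evalAll tbl11 r
  else if r.getD 0 0 = 12 then evalAll tbl12 r
  else if r.getD 0 0 = 20 then evalAll tbl20 r
  else if r.getD 0 0 = 21 then evalAll tbl21 r
  else if r.getD 0 0 = 22 then evalAll tbl22 r
  else if r.getD 0 0 = 24 then evalAll tbl24 r
  else if r.getD 0 0 = 30 then evalAll tbl30 r
  else if r.getD 0 0 = 31 then evalAll tbl31 r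
  else r

/-- Post-call update at `11` (a summand's bit `b` came back): `col += b`, `ix += 1`, flag cleared. [cite: KnuthTAOCP2, §4.3.1, Algorithm A (A2)] -/
def ptbl11 : List NEx := [.cst 11, rI, rK, rA, rW, rJ, .add rX (.cst 1), .add rC rB, rY, rB, .cst 0, rU, rS]

/-- Post-call update at `21` (first factor's bit `a` came back): save it in `u`, to `22`. [cite: KnuthTAOCP2, §4.3.1, Algorithm M (M3)] -/
def ptbl21 : List NEx := [.cst 22, rI, rK, rA, rW, rJ, rX, rC, rY, rB, .cst 0, rB, rS]

/-- Post-call update at `22` (second factor's bit `j − a` came back): `col += b`, `a += 1`, to `21`. [cite: KnuthTAOCP2, §4.3.1, Algorithm M (M4)] -/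
def ptbl22 : List NEx := [.cst 21, rI, rK, rA, rW, rJ, .add rX (.cst 1), .add rC rB, rY, rB, .cst 0, rU, rS]

/-- Post-call update at `31` (bit `j` of child `0` came back): save it in `u`, to `32`. [cite: KoiranPerifel2009VPSPACE, §3.2] -/
def ptbl31 : List NEx := [.cst 32, rI, rK, rA, rW, rJ, rX, rC, rY, rB, .cst 0, rB, rS]

/-- Post-call update at `32` (bit `j` of child `1` came back): equal to `u` ⇒ `j += 1`, back to `31`;
else to `36`. [cite: KoiranPerifel2009VPSPACE, §3.2] -/
def ptbl32 : List NEx :=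
  [.iteEq rB rU (.cst 31) (.cst 36), rI, rK, rA, rW, .iteEq rB rU (.add rJ (.cst 1)) rJ, rX, rC, rY, rB,
    .cst 0, rU, rS]

/-- Post-call update at `35` / `36` (bit `i` of the selected child came back): it is the answer, to `13`. [cite: KoiranPerifel2009VPSPACE, §3.2] -/
def ptbl35 : List NEx := [.cst 13, rI, rK, rA, rW, rJ, rX, rC, rY, rB, .cst 0, rU, rB]

/-- **The POST-CALL table** (flag set: a callee just returned the bit `b`), by program point. [cite: HomerSelman2011, Thm. 5.13 (proof, p. 97: "On return from this recursive call, execution resumes")] -/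
def postRegs (r : List ℕ) : List ℕ :=
  if r.getD 0 0 = 11 then evalAll ptbl11 r
  else if r.getD 0 0 = 21 then evalAll ptbl21 r
  else if r.getD 0 0 = 22 then evalAll ptbl22 r
  else if r.getD 0 0 = 31 then evalAll ptbl31 r
  else if r.getD 0 0 = 32 then evalAll ptbl32 r
  else evalAll ptbl35 r

/-- **When to CALL** (no pending return): at `11` while `ix < arity`; at `21` while `a ≤ j`; at `22`
when the first factor's bit is `1`; at `31` while `j < width`; always at `32`, `35`, `36`. [cite: KoiranPerifel2009VPSPACE, §3.2, Prop. 1 (proof)] -/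
def callNow (r : List ℕ) : Bool :=
  (decide (r.getD 0 0 = 11) && decide (r.getD 6 0 < r.getD 3 0)) ||
  (decide (r.getD 0 0 = 21) && decide (r.getD 6 0 ≤ r.getD 5 0)) ||
  (decide (r.getD 0 0 = 22) && decide (r.getD 11 0 = 1)) ||
  (decide (r.getD 0 0 = 31) && decide (r.getD 5 0 < r.getD 4 0)) ||
  decide (r.getD 0 0 = 32) || decide (r.getD 0 0 = 35) || decide (r.getD 0 0 = 36)

/-- Which child is called: at `11` child `ix`; at `21` / `31` child `0`; at `22` / `32` child `1`; at
`35` child `2`; at `36` child `3`. [cite: KoiranPerifel2009VPSPACE, §3.2, Prop. 1 (proof)] -/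
def childIxE : NEx :=
  .iteEq rPC (.cst 11) rX (.iteEq rPC (.cst 21) (.cst 0) (.iteEq rPC (.cst 22) (.cst 1)
    (.iteEq rPC (.cst 31) (.cst 0) (.iteEq rPC (.cst 32) (.cst 1) (.iteEq rPC (.cst 35) (.cst 2) (.cst 3))))))

/-- Which bit is asked of the callee: at `11` bit `j`; at `21` bit `a`; at `22` bit `j − a`; at `31` /
`32` bit `j`; at `35` / `36` bit `i`. [cite: KnuthTAOCP2, §4.3.1, Algorithms A, M] -/
def tgtBitE : NEx :=
  .iteEq rPC (.cst 11) rJ (.iteEq rPC (.cst 21) rX (.iteEq rPC (.cst 22) (.sub rJ rX)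
    (.iteEq rPC (.cst 31) rJ (.iteEq rPC (.cst 32) rJ rI))))

/-- The RESUME table: store the returned bit in `b`, raise the flag. [cite: HomerSelman2011, Thm. 5.13 (proof, p. 97)] -/
def resumeTbl (bit : Bool) : List NEx :=
  [rPC, rI, rK, rA, rW, rJ, rX, rC, rY, .cst (if bit then 1 else 0), .cst 1, rU, rS]

end Tables

variable (K : SuccCircuit)

/-- Program point `0` (a fresh call on gate `g`, bit `i`): cache `kind g`, `arity g`, `width g`, to `1`. [cite: KoiranPerifel2009VPSPACE, §3.2, Prop. 1 (proof)] -/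
def hdrRegs (g : List Bool) (i : ℕ) : List ℕ := [1, i, K.kind g, K.arity g, K.width g, 0, 0, 0, 0, 0, 0, 0, 0]

/-- The bit a CONSTANT gate returns: bit `i` of `cval g` (`testBit_cval`). [cite: KoiranPerifel2009VPSPACE, §3.2, Prop. 1 (proof: "input gates")] -/
def constBit (g : List Bool) (i : ℕ) : Bool := decide (i < K.width g) && K.cbit g i

/-- **One step of the evaluator** on an activation record `(g, regs)`: a pending return is
absorbed first (post-call table); program point `0` caches the gate's header; `2` returns the
constant's bit; `13` returns the answer bit; at a call point the callee "bit `tgtBit` of child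
`childIx`" is pushed; otherwise the continue table. [cite: KoiranPerifel2009VPSPACE, §3.2, Prop. 1 (proof)] [cite: HomerSelman2011, Thm. 5.13 (proof, p. 97)] -/
def stepSem (x : Frame) : Act :=
  if x.2.getD 10 0 = 1 then .cont (x.1, postRegs x.2)
  else if x.2.getD 0 0 = 0 then .cont (x.1, K.hdrRegs x.1 (x.2.getD 1 0))
  else if x.2.getD 0 0 = 2 then .ret [K.constBit x.1 (x.2.getD 1 0)]
  else if x.2.getD 0 0 = 13 then .ret [decide (x.2.getD 12 0 = 1)]
  else if callNow x.2 then .call (K.child x.1 (childIxE.eval x.2), initRegs (tgtBitE.eval x.2))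
  else .cont (x.1, contRegs x.2)

/-- **Resumption**: the waiting record absorbs the first bit of the returned value. [cite: HomerSelman2011, Thm. 5.13 (proof, p. 97)] -/
def resumeSem (x : Frame) (bit : Bool) : Frame := (x.1, NEx.evalAll (resumeTbl bit) x.2)

/-- The root activation record of a query `w = ⟨g, i⟩`. [cite: KoiranPerifel2009VPSPACE, §3.1, Def. 1] -/
def rootFrame (w : List Bool) : Frame := (fstF w, initRegs (bitsToNat (sndF w)))

/-! ### Codes: the evaluator is a recursive procedure -/

/-- `contRegs` is computed on codes. [cite: AroraBarak2009, §1.3] -/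
private theorem contRegs_code : CodeFP regsE regsE contRegs := by
  have hpc : ∀ c : ℕ, CodeFP regsE bitE (fun r => decide (r.getD 0 0 = c)) := fun c =>
    (natEq.comp ((NEx.reg 0).code.pair (const regsE c))).congr fun r => rfl
  refine ((hpc 1).ite (NEx.codeAll tbl1) ((hpc 10).ite (NEx.codeAll tbl10) ((hpc 11).ite (NEx.codeAll tbl11)
    ((hpc 12).ite (NEx.codeAll tbl12) ((hpc 20).ite (NEx.codeAll tbl20) ((hpc 21).ite (NEx.codeAll tbl21)
    ((hpc 22).ite (NEx.codeAll tbl22) ((hpc 24).ite (NEx.codeAll tbl24) ((hpc 30).ite (NEx.codeAll tbl30)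
    ((hpc 31).ite (NEx.codeAll tbl31) (CodeFP.id regsE))))))))))).congr fun r => ?_
  simp only [contRegs, decide_eq_true_eq]
  rfl

/-- `postRegs` is computed on codes. [cite: AroraBarak2009, §1.3] -/
private theorem postRegs_code : CodeFP regsE regsE postRegs := by
  have hpc : ∀ c : ℕ, CodeFP regsE bitE (fun r => decide (r.getD 0 0 = c)) := fun c =>
    (natEq.comp ((NEx.reg 0).code.pair (const regsE c))).congr fun r => rfl
  refine ((hpc 11).ite (NEx.codeAll ptbl11) ((hpc 21).ite (NEx.codeAll ptbl21) ((hpc 22).ite (NEx.codeAll ptbl22)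
    ((hpc 31).ite (NEx.codeAll ptbl31) ((hpc 32).ite (NEx.codeAll ptbl32) (NEx.codeAll ptbl35)))))).congr fun r => ?_
  simp only [postRegs, decide_eq_true_eq]

/-- `callNow` is computed on codes. [cite: AroraBarak2009, §1.3] -/
private theorem callNow_code : CodeFP regsE bitE callNow := by
  have hpc : ∀ c : ℕ, CodeFP regsE bitE (fun r => decide (r.getD 0 0 = c)) := fun c =>
    (natEq.comp ((NEx.reg 0).code.pair (const regsE c))).congr fun r => rfl
  have h6lt3 : CodeFP regsE bitE (fun r => decide (r.getD 6 0 < r.getD 3 0)) :=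
    (natLt.comp ((NEx.reg 6).code.pair (NEx.reg 3).code)).congr fun r => rfl
  have h6le5 : CodeFP regsE bitE (fun r => decide (r.getD 6 0 ≤ r.getD 5 0)) :=
    (natLe.comp ((NEx.reg 6).code.pair (NEx.reg 5).code)).congr fun r => rfl
  have h11 : CodeFP regsE bitE (fun r => decide (r.getD 11 0 = 1)) :=
    (natEq.comp ((NEx.reg 11).code.pair (const regsE (1 : ℕ)))).congr fun r => rfl
  have h5lt4 : CodeFP regsE bitE (fun r => decide (r.getD 5 0 < r.getD 4 0)) :=
    (natLt.comp ((NEx.reg 5).code.pair (NEx.reg 4).code)).congr fun r => rfl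
  exact (((((((hpc 11).and h6lt3).or ((hpc 21).and h6le5)).or ((hpc 22).and h11)).or ((hpc 31).and h5lt4)).or
    (hpc 32)).or (hpc 35)).or (hpc 36)

/-- `hdrRegs` is computed on codes (context `(g, regs)`). [cite: AroraBarak2009, §1.3] -/
private theorem hdrRegs_code : CodeFP frameE regsE (fun x => K.hdrRegs x.1 (x.2.getD 1 0)) := by
  have hg : CodeFP frameE strE (fun x => x.1) := fst _ _
  have hr : CodeFP frameE regsE (fun x => x.2) := snd _ _
  have hi : CodeFP frameE natE (fun x => x.2.getD 1 0) := (NEx.reg 1).code.comp hr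
  have c0 : CodeFP frameE natE (fun _ => (0 : ℕ)) := const _ _
  have hnil : CodeFP frameE regsE (fun _ => ([] : List ℕ)) := const _ _
  have cons : ∀ {a : Frame → ℕ} {l : Frame → List ℕ}, CodeFP frameE natE a → CodeFP frameE regsE l →
      CodeFP frameE regsE (fun x => a x :: l x) := fun {a l} ha hl => (rawCons natE).comp (ha.pair hl)
  exact (cons (const _ (1 : ℕ)) (cons hi (cons (K.kind_fp.comp hg) (cons (K.arity_fp.comp hg)
    (cons (K.width_fp.comp hg) (cons c0 (cons c0 (cons c0 (cons c0 (cons c0 (cons c0 (cons c0 (cons c0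
    hnil))))))))))))).congr fun x => rfl

/-- `initRegs` is computed on codes. [cite: AroraBarak2009, §1.3] -/
private theorem initRegs_code : CodeFP natE regsE initRegs := by
  have c0 : CodeFP natE natE (fun _ => (0 : ℕ)) := const _ _
  have hnil : CodeFP natE regsE (fun _ => ([] : List ℕ)) := const _ _
  have cons : ∀ {a : ℕ → ℕ} {l : ℕ → List ℕ}, CodeFP natE natE a → CodeFP natE regsE l →
      CodeFP natE regsE (fun x => a x :: l x) := fun {a l} ha hl => (rawCons natE).comp (ha.pair hl)
  exact (cons c0 (cons (CodeFP.id natE) (cons c0 (cons c0 (cons c0 (cons c0 (cons c0 (cons c0 (cons c0 (cons c0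
    (cons c0 (cons c0 (cons c0 hnil))))))))))))).congr fun x => rfl

/-- **The step is computed on codes.** [cite: AroraBarak2009, §1.3] [cite: HomerSelman2011, Thm. 5.13 (proof, p. 97)] -/
theorem stepSem_code : CodeFP frameE strE (fun x => actE (K.stepSem x)) := by
  have hg : CodeFP frameE strE (fun x => x.1) := fst _ _
  have hr : CodeFP frameE regsE (fun x => x.2) := snd _ _
  have hreg : ∀ k : ℕ, CodeFP frameE natE (fun x => x.2.getD k 0) := fun k => (NEx.reg k).code.comp hr
  have htest : ∀ k c : ℕ, CodeFP frameE bitE (fun x => decide (x.2.getD k 0 = c)) := fun k c =>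
    (natEq.comp ((hreg k).pair (const frameE c))).congr fun x => rfl
  -- tagging a frame / a bit
  have tagFrame : ∀ (t : List Bool) (F : Frame → Frame), CodeFP frameE frameE F →
      CodeFP frameE strE (fun x => t ++ frameE (F x)) := fun t F hF =>
    strAppend.comp ((const frameE t).pair (hF.recodeOut (eγ := strE) fun _ => rfl))
  have tagBit : ∀ (b : Frame → Bool), CodeFP frameE bitE b → CodeFP frameE strE (fun x => true :: [b x]) :=
    fun b hb => (strAppend.comp ((const frameE [true]).pair (hb.recodeOut (eγ := strE) fun _ => rfl))).congr
      fun x => rfl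
  -- the branches
  have hpost : CodeFP frameE strE (fun x => [false, false] ++ frameE (x.1, postRegs x.2)) :=
    tagFrame [false, false] _ (hg.pair (postRegs_code.comp hr))
  have hhdr : CodeFP frameE strE (fun x => [false, false] ++ frameE (x.1, K.hdrRegs x.1 (x.2.getD 1 0))) :=
    tagFrame [false, false] _ (hg.pair K.hdrRegs_code)
  have hconst : CodeFP frameE strE (fun x => true :: [K.constBit x.1 (x.2.getD 1 0)]) :=
    tagBit _ ((natLt.comp ((hreg 1).pair (K.width_fp.comp hg))).and (K.cbit_fp.comp (hg.pair (hreg 1))))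
  have hans : CodeFP frameE strE (fun x => true :: [decide (x.2.getD 12 0 = 1)]) := tagBit _ (htest 12 1)
  have hcall : CodeFP frameE strE (fun x => [false, true] ++
      frameE (K.child x.1 (childIxE.eval x.2), initRegs (tgtBitE.eval x.2))) :=
    tagFrame [false, true] _ ((K.child_fp.comp (hg.pair (childIxE.code.comp hr))).pair
      (initRegs_code.comp (tgtBitE.code.comp hr)))
  have hcont : CodeFP frameE strE (fun x => [false, false] ++ frameE (x.1, contRegs x.2)) :=
    tagFrame [false, false] _ (hg.pair (contRegs_code.comp hr))
  refine ((htest 10 1).ite hpost ((htest 0 0).ite hhdr ((htest 0 2).ite hconst ((htest 0 13).ite hans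
    ((callNow_code.comp hr).ite hcall hcont))))).congr fun x => ?_
  simp only [stepSem, decide_eq_true_eq]
  split_ifs <;> rfl

/-- **Resumption is computed on codes** (context `⟨frame, value⟩`, coded by `boolPair`). [cite: AroraBarak2009, §1.3] -/
theorem resumeSem_code : CodeFP (pairE frameE strE) frameE (fun p => resumeSem p.1 (p.2.getD 0 false)) := by
  have hg : CodeFP (pairE frameE strE) strE (fun p => p.1.1) := (fst _ _).fst'
  have hr : CodeFP (pairE frameE strE) regsE (fun p => p.1.2) := (fst _ _).snd'
  have hb : CodeFP (pairE frameE strE) bitE (fun p => p.2.getD 0 false) :=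
    strGetDNat.comp ((snd _ _).pair (const _ (0 : ℕ)))
  have ht : CodeFP (pairE frameE strE) regsE (fun p => NEx.evalAll (resumeTbl true) p.1.2) :=
    (NEx.codeAll _).comp hr
  have hf : CodeFP (pairE frameE strE) regsE (fun p => NEx.evalAll (resumeTbl false) p.1.2) :=
    (NEx.codeAll _).comp hr
  refine (hg.pair (hb.ite ht hf)).congr fun p => ?_
  simp only [resumeSem]
  cases p.2.getD 0 false <;> rfl

/-- **The root record is computed on codes** (on every string, through the total decoders). [cite: AroraBarak2009, §1.3] -/
theorem rootFrame_code : CodeFP strE frameE rootFrame := by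
  have h1 : CodeFP strE strE fstF := of_fn fstF fstF_mem_FP fun _ => rfl
  have h2 : CodeFP strE natE (fun w => bitsToNat (sndF w)) := strVal.comp (of_fn sndF sndF_mem_FP fun _ => rfl)
  exact (h1.pair (initRegs_code.comp h2)).congr fun w => rfl

/-- **The evaluator as a recursive procedure**: its step, resume and init are the `FP` string
functions realising `stepSem`, `resumeSem`, `rootFrame` on codes. [cite: HomerSelman2011, Thm. 5.13 (proof, p. 97)] [cite: KoiranPerifel2009VPSPACE, §3.2, Prop. 1] -/
def evalProc : RecProc where
  step := Classical.choose K.stepSem_code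
  resume := Classical.choose resumeSem_code
  init := Classical.choose rootFrame_code
  step_mem := (Classical.choose_spec K.stepSem_code).1
  resume_mem := (Classical.choose_spec resumeSem_code).1
  init_mem := (Classical.choose_spec rootFrame_code).1

/-- The step on the code of a record is the code of its action. [cite: HomerSelman2011, Thm. 5.13 (proof, p. 97)] -/
theorem step_frameE (x : Frame) : K.evalProc.step (frameE x) = actE (K.stepSem x) := by
  unfold evalProc
  exact (Classical.choose_spec K.stepSem_code).2 x

/-- Resumption on codes. [cite: HomerSelman2011, Thm. 5.13 (proof, p. 97)] -/
theorem resume_frameE (x : Frame) (v : List Bool) :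
    K.evalProc.resume (boolPair (frameE x) v) = frameE (resumeSem x (v.getD 0 false)) := by
  unfold evalProc
  exact (Classical.choose_spec resumeSem_code).2 (x, v)

/-- The root record on codes. [cite: HomerSelman2011, Thm. 5.13 (proof, p. 97)] -/
theorem init_eq (w : List Bool) : K.evalProc.init w = frameE (rootFrame w) := by
  unfold evalProc
  exact (Classical.choose_spec rootFrame_code).2 w

/-- Codes of records are distinct for distinct records (pair and list codes are injective). [cite: AroraBarak2009, §0.1] -/
theorem frameE_injective : Function.Injective frameE :=
  pairE_injective (fun _ _ h => h) (rawE_injective natE_injective)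

/-! ### Tags of actions -/

/-- A continue action is tagged `00` and carries the updated record. [cite: HomerSelman2011, Thm. 5.13 (proof, p. 97)] -/
theorem actE_cont (x : Frame) : (actE (.cont x)).getD 0 false = false ∧ (actE (.cont x)).getD 1 false = false ∧
    (actE (.cont x)).drop 2 = frameE x := ⟨rfl, rfl, rfl⟩

/-- A call action is tagged `01` and carries the callee. [cite: HomerSelman2011, Thm. 5.13 (proof, p. 97)] -/
theorem actE_call (x : Frame) : (actE (.call x)).getD 0 false = false ∧ (actE (.call x)).getD 1 false = true ∧
    (actE (.call x)).drop 2 = frameE x := ⟨rfl, rfl, rfl⟩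

/-- A return action is tagged `1` and carries the value. [cite: HomerSelman2011, Thm. 5.13 (proof, p. 97)] -/
theorem actE_ret (v : List Bool) : (actE (.ret v)).getD 0 false = true ∧ (actE (.ret v)).drop 1 = v := ⟨rfl, rfl⟩

/-! ### The big-step semantics at frame level -/

/-- A record whose step returns `v` returns `v`. [cite: HomerSelman2011, Thm. 5.13 (proof, p. 97)] -/
theorem returns_ret {x : Frame} {v : List Bool} (h : K.stepSem x = .ret v) : K.evalProc.Returns (frameE x) v := by
  have h0 : (K.evalProc.step (frameE x)).getD 0 false = true := by rw [step_frameE, h]; rfl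
  have := RecProc.Returns.ret (P := K.evalProc) h0
  rwa [step_frameE, h] at this

/-- A record whose step continues as `x'` returns what `x'` returns. [cite: HomerSelman2011, Thm. 5.13 (proof, p. 97)] -/
theorem returns_cont {x x' : Frame} {v : List Bool} (h : K.stepSem x = .cont x')
    (h' : K.evalProc.Returns (frameE x') v) : K.evalProc.Returns (frameE x) v := by
  refine RecProc.Returns.cont (P := K.evalProc) ?_ ?_ ?_ <;> rw [step_frameE, h]
  · rfl
  · rfl
  · exact h'

/-- A record whose step calls `y` returns what its resumption with `y`'s value returns. [cite: HomerSelman2011, Thm. 5.13 (proof, p. 97)] -/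
theorem returns_call {x y : Frame} {u v : List Bool} (h : K.stepSem x = .call y)
    (hu : K.evalProc.Returns (frameE y) u) (hv : K.evalProc.Returns (frameE (resumeSem x (u.getD 0 false))) v) :
    K.evalProc.Returns (frameE x) v := by
  refine RecProc.Returns.call (P := K.evalProc) (u := u) ?_ ?_ ?_ ?_
  · rw [step_frameE, h]; rfl
  · rw [step_frameE, h]; rfl
  · rw [step_frameE, h]; exact hu
  · rw [resume_frameE]; exact hv

/-- **Rule induction at frame level.** To prove `Q x v` whenever an `I`-record `x` returns `v`:
returning steps of `I`-records satisfy `Q`; continue steps preserve `I` and pull `Q` back; a call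
from an `I`-record pushes an `I`-callee and, once the callee's value `u` satisfies `Q`, the resumed
record is `I` and `Q` pulls back through it. [cite: HomerSelman2011, Thm. 5.13 (proof, p. 97)] -/
theorem returns_frame_induct {I : Frame → Prop} {Q : Frame → List Bool → Prop}
    (hret : ∀ x v, I x → K.stepSem x = .ret v → Q x v)
    (hcontI : ∀ x x', I x → K.stepSem x = .cont x' → I x')
    (hcont : ∀ x x' v, I x → K.stepSem x = .cont x' → Q x' v → Q x v)
    (hcallI : ∀ x y, I x → K.stepSem x = .call y → I y)
    (hres : ∀ x y u, I x → K.stepSem x = .call y → Q y u →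
      I (resumeSem x (u.getD 0 false)) ∧ ∀ v, Q (resumeSem x (u.getD 0 false)) v → Q x v)
    {x : Frame} {v : List Bool} (h : K.evalProc.Returns (frameE x) v) (hx : I x) : Q x v := by
  -- transport `I`, `Q` to strings along the injective code `frameE`
  have key := RecProc.Returns.induct_inv (P := K.evalProc) (Inv := fun f => ∃ x, f = frameE x ∧ I x)
    (Q := fun f v => ∀ x, f = frameE x → Q x v) ?_ ?_ ?_ ?_ ?_ ?_ h ⟨x, rfl, hx⟩
  · exact key x rfl
  · -- RETURN steps
    rintro f ⟨x, rfl, hIx⟩ h0 x' hx'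
    obtain rfl := frameE_injective hx'
    rw [step_frameE] at h0 ⊢
    cases hs : K.stepSem x with
    | cont y => rw [hs] at h0; exact absurd h0 (by simp [actE])
    | call y => rw [hs] at h0; exact absurd h0 (by simp [actE])
    | ret v' => exact hret x v' hIx hs
  · -- CONTINUE keeps the invariant
    rintro f ⟨x, rfl, hIx⟩ h0 h1
    rw [step_frameE] at h0 h1 ⊢
    cases hs : K.stepSem x with
    | cont y => exact ⟨y, rfl, hcontI x y hIx hs⟩
    | call y => rw [hs] at h1; exact absurd h1 (by simp [actE])
    | ret v' => rw [hs] at h0; exact absurd h0 (by simp [actE])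
  · -- CONTINUE pulls `Q` back
    rintro f v ⟨x, rfl, hIx⟩ h0 h1 - hQ x' hx'
    obtain rfl := frameE_injective hx'
    rw [step_frameE] at h0 h1 hQ
    cases hs : K.stepSem x with
    | cont y => rw [hs] at hQ; exact hcont x y v hIx hs (hQ y rfl)
    | call y => rw [hs] at h1; exact absurd h1 (by simp [actE])
    | ret v' => rw [hs] at h0; exact absurd h0 (by simp [actE])
  · -- CALL pushes an invariant callee
    rintro f ⟨x, rfl, hIx⟩ h0 h1
    rw [step_frameE] at h0 h1 ⊢
    cases hs : K.stepSem x with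
    | cont y => rw [hs] at h1; exact absurd h1 (by simp [actE])
    | call y => exact ⟨y, rfl, hcallI x y hIx hs⟩
    | ret v' => rw [hs] at h0; exact absurd h0 (by simp [actE])
  · -- the resumed caller is invariant
    rintro f u ⟨x, rfl, hIx⟩ h0 h1 - hQ
    rw [step_frameE] at h0 h1 hQ
    cases hs : K.stepSem x with
    | cont y => rw [hs] at h1; exact absurd h1 (by simp [actE])
    | call y =>
      rw [hs] at hQ
      exact ⟨resumeSem x (u.getD 0 false), K.resume_frameE x u, (hres x y u hIx hs (hQ y rfl)).1⟩
    | ret v' => rw [hs] at h0; exact absurd h0 (by simp [actE])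
  · -- CALL pulls `Q` back through the resumed caller
    rintro f u v ⟨x, rfl, hIx⟩ h0 h1 - hQu - hQv x' hx'
    obtain rfl := frameE_injective hx'
    rw [step_frameE] at h0 h1 hQu
    rw [resume_frameE] at hQv
    cases hs : K.stepSem x with
    | cont y => rw [hs] at h1; exact absurd h1 (by simp [actE])
    | call y =>
      rw [hs] at hQu
      exact (hres x y u hIx hs (hQu y rfl)).2 v (hQv _ rfl)
    | ret v' => rw [hs] at h0; exact absurd h0 (by simp [actE])


/-! ### Register files as records, and the step lemmas per program point -/

/-- The register file as a record (the fields of an activation record). [cite: HomerSelman2011, Thm. 5.13 (proof, p. 97: activation records)] -/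
structure Regs where
  /-- program point -/
  pc : ℕ
  /-- the bit this call must return -/
  i : ℕ
  /-- cached kind -/
  kd : ℕ
  /-- cached arity -/
  ar : ℕ
  /-- cached width -/
  wd : ℕ
  /-- current column / compared bit -/
  j : ℕ
  /-- current summand / convolution term -/
  ix : ℕ
  /-- partial column sum -/
  col : ℕ
  /-- carry -/
  cy : ℕ
  /-- bit last returned by a callee -/
  b : ℕ
  /-- pending-return flag -/
  fl : ℕ
  /-- saved bit -/
  u : ℕ
  /-- answer bit -/
  ans : ℕ

/-- The register file of a record. [cite: HomerSelman2011, Thm. 5.13 (proof, p. 97)] -/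
def Regs.toList (ρ : Regs) : List ℕ :=
  [ρ.pc, ρ.i, ρ.kd, ρ.ar, ρ.wd, ρ.j, ρ.ix, ρ.col, ρ.cy, ρ.b, ρ.fl, ρ.u, ρ.ans]

/-- A fresh call's register file as a record. [cite: HomerSelman2011, Thm. 5.13 (proof, p. 97: "The initial call")] -/
theorem initRegs_eq (t : ℕ) : initRegs t = (⟨0, t, 0, 0, 0, 0, 0, 0, 0, 0, 0, 0, 0⟩ : Regs).toList := rfl

/-- The header register file as a record. [cite: KoiranPerifel2009VPSPACE, §3.2, Prop. 1 (proof)] -/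
theorem hdrRegs_eq (g : List Bool) (i : ℕ) :
    K.hdrRegs g i = (⟨1, i, K.kind g, K.arity g, K.width g, 0, 0, 0, 0, 0, 0, 0, 0⟩ : Regs).toList := rfl

section StepLemmas

variable (g : List Bool) (ρ : Regs)

/-- Post-call step at `11`: `col += b`, `ix += 1`, flag cleared. [cite: KnuthTAOCP2, §4.3.1, Algorithm A (A2)] -/
theorem stepSem_post11 (h : ρ.fl = 1) (hpc : ρ.pc = 11) : K.stepSem (g, ρ.toList) =
    .cont (g, (⟨11, ρ.i, ρ.kd, ρ.ar, ρ.wd, ρ.j, ρ.ix + 1, ρ.col + ρ.b, ρ.cy, ρ.b, 0, ρ.u, ρ.ans⟩ : Regs).toList) := by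
  simp [stepSem, postRegs, h, hpc, NEx.evalAll, NEx.eval, ptbl11, Regs.toList]

/-- Post-call step at `21`: `u := b`, to `22`. [cite: KnuthTAOCP2, §4.3.1, Algorithm M (M3)] -/
theorem stepSem_post21 (h : ρ.fl = 1) (hpc : ρ.pc = 21) : K.stepSem (g, ρ.toList) =
    .cont (g, (⟨22, ρ.i, ρ.kd, ρ.ar, ρ.wd, ρ.j, ρ.ix, ρ.col, ρ.cy, ρ.b, 0, ρ.b, ρ.ans⟩ : Regs).toList) := by
  simp [stepSem, postRegs, h, hpc, NEx.evalAll, NEx.eval, ptbl21, Regs.toList]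

/-- Post-call step at `22`: `col += b`, `a += 1`, to `21`. [cite: KnuthTAOCP2, §4.3.1, Algorithm M (M4)] -/
theorem stepSem_post22 (h : ρ.fl = 1) (hpc : ρ.pc = 22) : K.stepSem (g, ρ.toList) =
    .cont (g, (⟨21, ρ.i, ρ.kd, ρ.ar, ρ.wd, ρ.j, ρ.ix + 1, ρ.col + ρ.b, ρ.cy, ρ.b, 0, ρ.u, ρ.ans⟩ : Regs).toList) := by
  simp [stepSem, postRegs, h, hpc, NEx.evalAll, NEx.eval, ptbl22, Regs.toList]

/-- Post-call step at `31`: `u := b`, to `32`. [cite: KoiranPerifel2009VPSPACE, §3.2] -/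
theorem stepSem_post31 (h : ρ.fl = 1) (hpc : ρ.pc = 31) : K.stepSem (g, ρ.toList) =
    .cont (g, (⟨32, ρ.i, ρ.kd, ρ.ar, ρ.wd, ρ.j, ρ.ix, ρ.col, ρ.cy, ρ.b, 0, ρ.b, ρ.ans⟩ : Regs).toList) := by
  simp [stepSem, postRegs, h, hpc, NEx.evalAll, NEx.eval, ptbl31, Regs.toList]

/-- Post-call step at `32`: equal bits ⇒ `j += 1`, back to `31`; else to `36`. [cite: KoiranPerifel2009VPSPACE, §3.2] -/
theorem stepSem_post32 (h : ρ.fl = 1) (hpc : ρ.pc = 32) : K.stepSem (g, ρ.toList) =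
    .cont (g, (⟨if ρ.b = ρ.u then 31 else 36, ρ.i, ρ.kd, ρ.ar, ρ.wd, if ρ.b = ρ.u then ρ.j + 1 else ρ.j, ρ.ix, ρ.col,
      ρ.cy, ρ.b, 0, ρ.u, ρ.ans⟩ : Regs).toList) := by
  simp [stepSem, postRegs, h, hpc, NEx.evalAll, NEx.eval, ptbl32, Regs.toList]

/-- Post-call step at `35` / `36`: the returned bit is the answer, to `13`. [cite: KoiranPerifel2009VPSPACE, §3.2] -/
theorem stepSem_post35_36 (h : ρ.fl = 1) (hpc : ρ.pc = 35 ∨ ρ.pc = 36) : K.stepSem (g, ρ.toList) =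
    .cont (g, (⟨13, ρ.i, ρ.kd, ρ.ar, ρ.wd, ρ.j, ρ.ix, ρ.col, ρ.cy, ρ.b, 0, ρ.u, ρ.b⟩ : Regs).toList) := by
  rcases hpc with hpc | hpc <;> simp [stepSem, postRegs, h, hpc, NEx.evalAll, NEx.eval, ptbl35, Regs.toList]

/-- Step at program point `0`: cache the header. [cite: KoiranPerifel2009VPSPACE, §3.2, Prop. 1 (proof)] -/
theorem stepSem_pc0 (hf : ρ.fl ≠ 1) (h : ρ.pc = 0) :
    K.stepSem (g, ρ.toList) = .cont (g, (⟨1, ρ.i, K.kind g, K.arity g, K.width g, 0, 0, 0, 0, 0, 0, 0, 0⟩ : Regs).toList) := by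
  simp [stepSem, hf, h, hdrRegs, Regs.toList]

/-- Step at program point `2`: return the constant's bit. [cite: KoiranPerifel2009VPSPACE, §3.2, Prop. 1 (proof: "input gates")] -/
theorem stepSem_pc2 (hf : ρ.fl ≠ 1) (h : ρ.pc = 2) : K.stepSem (g, ρ.toList) = .ret [K.constBit g ρ.i] := by
  simp [stepSem, hf, h, Regs.toList]

/-- Step at program point `13`: return the answer bit. [cite: KoiranPerifel2009VPSPACE, §3.2, Prop. 1 (proof)] -/
theorem stepSem_pc13 (hf : ρ.fl ≠ 1) (h : ρ.pc = 13) : K.stepSem (g, ρ.toList) = .ret [decide (ρ.ans = 1)] := by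
  simp [stepSem, hf, h, Regs.toList]

/-- Step at program point `1`: dispatch on the kind. [cite: KoiranPerifel2009VPSPACE, §3.2, Prop. 1 (proof)] -/
theorem stepSem_pc1 (hf : ρ.fl ≠ 1) (h : ρ.pc = 1) : K.stepSem (g, ρ.toList) = .cont (g,
    (⟨if ρ.kd = 1 then 10 else if ρ.kd = 2 then 20 else if ρ.kd = 3 then 30 else 2, ρ.i, ρ.kd, ρ.ar, ρ.wd, ρ.j,
      ρ.ix, ρ.col, ρ.cy, ρ.b, ρ.fl, ρ.u, ρ.ans⟩ : Regs).toList) := by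
  simp [stepSem, hf, h, callNow, contRegs, NEx.evalAll, NEx.eval, tbl1, Regs.toList]

/-- Step at the loop head `10` (sum): initialise the loop registers. [cite: KnuthTAOCP2, §4.3.1, Algorithm A (A1)] -/
theorem stepSem_pc10 (hf : ρ.fl ≠ 1) (h : ρ.pc = 10) : K.stepSem (g, ρ.toList) =
    .cont (g, (⟨11, ρ.i, ρ.kd, ρ.ar, ρ.wd, 0, 0, 0, 0, ρ.b, ρ.fl, ρ.u, ρ.ans⟩ : Regs).toList) := by
  simp [stepSem, hf, h, callNow, contRegs, NEx.evalAll, NEx.eval, tbl10, Regs.toList]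

/-- Step at the loop head `20` (product): initialise the loop registers. [cite: KnuthTAOCP2, §4.3.1, Algorithm M (M1)] -/
theorem stepSem_pc20 (hf : ρ.fl ≠ 1) (h : ρ.pc = 20) : K.stepSem (g, ρ.toList) =
    .cont (g, (⟨21, ρ.i, ρ.kd, ρ.ar, ρ.wd, 0, 0, 0, 0, ρ.b, ρ.fl, ρ.u, ρ.ans⟩ : Regs).toList) := by
  simp [stepSem, hf, h, callNow, contRegs, NEx.evalAll, NEx.eval, tbl20, Regs.toList]

/-- Step at the loop head `30` (select): `j := 0`. [cite: KoiranPerifel2009VPSPACE, §3.2] -/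
theorem stepSem_pc30 (hf : ρ.fl ≠ 1) (h : ρ.pc = 30) : K.stepSem (g, ρ.toList) =
    .cont (g, (⟨31, ρ.i, ρ.kd, ρ.ar, ρ.wd, 0, ρ.ix, ρ.col, ρ.cy, ρ.b, ρ.fl, ρ.u, ρ.ans⟩ : Regs).toList) := by
  simp [stepSem, hf, h, callNow, contRegs, NEx.evalAll, NEx.eval, tbl30, Regs.toList]

/-- Step at `11` while `ix < arity`: call summand `ix`'s bit `j`. [cite: KnuthTAOCP2, §4.3.1, Algorithm A (A2)] -/
theorem stepSem_pc11_call (hf : ρ.fl ≠ 1) (h : ρ.pc = 11) (hlt : ρ.ix < ρ.ar) :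
    K.stepSem (g, ρ.toList) = .call (K.child g ρ.ix, initRegs ρ.j) := by
  simp [stepSem, hf, h, hlt, callNow, childIxE, tgtBitE, NEx.eval, Regs.toList]

/-- Step at `11` once `ix ≥ arity` (column complete): to `12`. [cite: KnuthTAOCP2, §4.3.1, Algorithm A (A2)] -/
theorem stepSem_pc11_done (hf : ρ.fl ≠ 1) (h : ρ.pc = 11) (hlt : ¬ ρ.ix < ρ.ar) : K.stepSem (g, ρ.toList) =
    .cont (g, (⟨12, ρ.i, ρ.kd, ρ.ar, ρ.wd, ρ.j, ρ.ix, ρ.col, ρ.cy, ρ.b, ρ.fl, ρ.u, ρ.ans⟩ : Regs).toList) := by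
  simp [stepSem, hf, h, hlt, callNow, contRegs, NEx.evalAll, NEx.eval, tbl11, Regs.toList]

/-- Step at `12` / `24` with `j = i` (the last column): the answer is `(col + carry) mod 2`, to `13`. [cite: KnuthTAOCP2, §4.3.1, Algorithms A (A3), M (M6)] -/
theorem stepSem_pc12_24_last (hf : ρ.fl ≠ 1) (h : ρ.pc = 12 ∨ ρ.pc = 24) (hji : ρ.j = ρ.i) : K.stepSem (g, ρ.toList) =
    .cont (g, (⟨13, ρ.i, ρ.kd, ρ.ar, ρ.wd, ρ.j, ρ.ix, ρ.col, ρ.cy, ρ.b, ρ.fl, ρ.u, (ρ.col + ρ.cy) % 2⟩ : Regs).toList) := by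
  rcases h with h | h
  · simp [stepSem, hf, h, hji, callNow, contRegs, NEx.evalAll, NEx.eval, tbl12, Regs.toList]
  · simp [stepSem, hf, h, hji, callNow, contRegs, NEx.evalAll, NEx.eval, tbl24, Regs.toList]

/-- Step at `12` with `j ≠ i`: `carry := ⌊(col + carry)/2⌋`, `col, ix := 0`, `j := j + 1`, back to `11`. [cite: KnuthTAOCP2, §4.3.1, Algorithm A (A2–A3)] -/
theorem stepSem_pc12_next (hf : ρ.fl ≠ 1) (h : ρ.pc = 12) (hji : ρ.j ≠ ρ.i) : K.stepSem (g, ρ.toList) =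
    .cont (g, (⟨11, ρ.i, ρ.kd, ρ.ar, ρ.wd, ρ.j + 1, 0, 0, (ρ.col + ρ.cy) / 2, ρ.b, ρ.fl, ρ.u, ρ.ans⟩ : Regs).toList) := by
  simp [stepSem, hf, h, hji, callNow, contRegs, NEx.evalAll, NEx.eval, tbl12, Regs.toList]

/-- Step at `24` with `j ≠ i`: `carry := ⌊(col + carry)/2⌋`, `col, a := 0`, `j := j + 1`, back to `21`. [cite: KnuthTAOCP2, §4.3.1, Algorithm M (M5–M6)] -/
theorem stepSem_pc24_next (hf : ρ.fl ≠ 1) (h : ρ.pc = 24) (hji : ρ.j ≠ ρ.i) : K.stepSem (g, ρ.toList) =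
    .cont (g, (⟨21, ρ.i, ρ.kd, ρ.ar, ρ.wd, ρ.j + 1, 0, 0, (ρ.col + ρ.cy) / 2, ρ.b, ρ.fl, ρ.u, ρ.ans⟩ : Regs).toList) := by
  simp [stepSem, hf, h, hji, callNow, contRegs, NEx.evalAll, NEx.eval, tbl24, Regs.toList]

/-- Step at `21` while `a ≤ j`: call the first factor's bit `a`. [cite: KnuthTAOCP2, §4.3.1, Algorithm M (M3)] -/
theorem stepSem_pc21_call (hf : ρ.fl ≠ 1) (h : ρ.pc = 21) (hle : ρ.ix ≤ ρ.j) :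
    K.stepSem (g, ρ.toList) = .call (K.child g 0, initRegs ρ.ix) := by
  simp [stepSem, hf, h, hle, callNow, childIxE, tgtBitE, NEx.eval, Regs.toList]

/-- Step at `21` once `a > j` (convolution column complete): to `24`. [cite: KnuthTAOCP2, §4.3.1, Algorithm M] -/
theorem stepSem_pc21_done (hf : ρ.fl ≠ 1) (h : ρ.pc = 21) (hle : ¬ ρ.ix ≤ ρ.j) : K.stepSem (g, ρ.toList) =
    .cont (g, (⟨24, ρ.i, ρ.kd, ρ.ar, ρ.wd, ρ.j, ρ.ix, ρ.col, ρ.cy, ρ.b, ρ.fl, ρ.u, ρ.ans⟩ : Regs).toList) := by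
  simp [stepSem, hf, h, hle, callNow, contRegs, NEx.evalAll, NEx.eval, tbl21, Regs.toList]

/-- Step at `22` with `u = 1`: call the second factor's bit `j − a`. [cite: KnuthTAOCP2, §4.3.1, Algorithm M (M4)] -/
theorem stepSem_pc22_call (hf : ρ.fl ≠ 1) (h : ρ.pc = 22) (hu : ρ.u = 1) :
    K.stepSem (g, ρ.toList) = .call (K.child g 1, initRegs (ρ.j - ρ.ix)) := by
  simp [stepSem, hf, h, hu, callNow, childIxE, tgtBitE, NEx.eval, Regs.toList]

/-- Step at `22` with `u ≠ 1` (the term vanishes): `a := a + 1`, back to `21`. [cite: KnuthTAOCP2, §4.3.1, Algorithm M (M4: "if uⱼ = 0 …")] -/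
theorem stepSem_pc22_skip (hf : ρ.fl ≠ 1) (h : ρ.pc = 22) (hu : ρ.u ≠ 1) : K.stepSem (g, ρ.toList) =
    .cont (g, (⟨21, ρ.i, ρ.kd, ρ.ar, ρ.wd, ρ.j, ρ.ix + 1, ρ.col, ρ.cy, ρ.b, ρ.fl, ρ.u, ρ.ans⟩ : Regs).toList) := by
  simp [stepSem, hf, h, hu, callNow, contRegs, NEx.evalAll, NEx.eval, tbl22, Regs.toList]

/-- Step at `31` while `j < width`: call child `0`'s bit `j`. [cite: KoiranPerifel2009VPSPACE, §3.2] -/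
theorem stepSem_pc31_call (hf : ρ.fl ≠ 1) (h : ρ.pc = 31) (hlt : ρ.j < ρ.wd) :
    K.stepSem (g, ρ.toList) = .call (K.child g 0, initRegs ρ.j) := by
  simp [stepSem, hf, h, hlt, callNow, childIxE, tgtBitE, NEx.eval, Regs.toList]

/-- Step at `31` once `j ≥ width` (all compared bits agree): to `35`. [cite: KoiranPerifel2009VPSPACE, §3.2] -/
theorem stepSem_pc31_done (hf : ρ.fl ≠ 1) (h : ρ.pc = 31) (hlt : ¬ ρ.j < ρ.wd) : K.stepSem (g, ρ.toList) =
    .cont (g, (⟨35, ρ.i, ρ.kd, ρ.ar, ρ.wd, ρ.j, ρ.ix, ρ.col, ρ.cy, ρ.b, ρ.fl, ρ.u, ρ.ans⟩ : Regs).toList) := by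
  simp [stepSem, hf, h, hlt, callNow, contRegs, NEx.evalAll, NEx.eval, tbl31, Regs.toList]

/-- Step at `32`: call child `1`'s bit `j`. [cite: KoiranPerifel2009VPSPACE, §3.2] -/
theorem stepSem_pc32 (hf : ρ.fl ≠ 1) (h : ρ.pc = 32) : K.stepSem (g, ρ.toList) = .call (K.child g 1, initRegs ρ.j) := by
  simp [stepSem, hf, h, callNow, childIxE, tgtBitE, NEx.eval, Regs.toList]

/-- Step at `35`: call child `2`'s bit `i`. [cite: KoiranPerifel2009VPSPACE, §3.2] -/
theorem stepSem_pc35 (hf : ρ.fl ≠ 1) (h : ρ.pc = 35) : K.stepSem (g, ρ.toList) = .call (K.child g 2, initRegs ρ.i) := by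
  simp [stepSem, hf, h, callNow, childIxE, tgtBitE, NEx.eval, Regs.toList]

/-- Step at `36`: call child `3`'s bit `i`. [cite: KoiranPerifel2009VPSPACE, §3.2] -/
theorem stepSem_pc36 (hf : ρ.fl ≠ 1) (h : ρ.pc = 36) : K.stepSem (g, ρ.toList) = .call (K.child g 3, initRegs ρ.i) := by
  simp [stepSem, hf, h, callNow, childIxE, tgtBitE, NEx.eval, Regs.toList]

/-- Resumption as a record update: `b := bit`, flag raised. [cite: HomerSelman2011, Thm. 5.13 (proof, p. 97)] -/
theorem resumeSem_eq (bit : Bool) : resumeSem (g, ρ.toList) bit =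
    (g, (⟨ρ.pc, ρ.i, ρ.kd, ρ.ar, ρ.wd, ρ.j, ρ.ix, ρ.col, ρ.cy, if bit then 1 else 0, 1, ρ.u, ρ.ans⟩ : Regs).toList) := rfl

end StepLemmas

/-! ### The certificate: well-formed records, rank = depth, potential = loop measure -/

section Certificate

/-- **Header sizes**: `kind g`, `arity g`, `width g` are `< 2^{H(|g|)}` for a polynomial `H` (their
numerals are outputs of polynomial-time functions). [cite: AroraBarak2009, §1.3] -/
theorem exists_hdrPoly : ∃ H : Polynomial ℕ, ∀ g : List Bool,
    K.kind g < 2 ^ H.eval g.length ∧ K.arity g < 2 ^ H.eval g.length ∧ K.width g < 2 ^ H.eval g.length := by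
  obtain ⟨fk, hfk, hk⟩ := K.kind_fp
  obtain ⟨fa, hfa, ha⟩ := K.arity_fp
  obtain ⟨fw, hfw, hw⟩ := K.width_fp
  obtain ⟨sk, hsk⟩ := exists_poly_length_le_of_mem_FP hfk
  obtain ⟨sa, hsa⟩ := exists_poly_length_le_of_mem_FP hfa
  obtain ⟨sw, hsw⟩ := exists_poly_length_le_of_mem_FP hfw
  refine ⟨sk + sa + sw, fun g => ?_⟩
  have h1 : (natE (K.kind g)).length ≤ (sk + sa + sw).eval g.length := by
    rw [← hk g, eval_add, eval_add]; exact (hsk g).trans (by omega)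
  have h2 : (natE (K.arity g)).length ≤ (sk + sa + sw).eval g.length := by
    rw [← ha g, eval_add, eval_add]; exact (hsa g).trans (by omega)
  have h3 : (natE (K.width g)).length ≤ (sk + sa + sw).eval g.length := by
    rw [← hw g, eval_add, eval_add]; exact (hsw g).trans (by omega)
  exact ⟨(length_encodeNat_le_iff _ _).1 h1, (length_encodeNat_le_iff _ _).1 h2, (length_encodeNat_le_iff _ _).1 h3⟩

/-- The header polynomial `H`. [cite: AroraBarak2009, §1.3] -/
def hdrPoly : Polynomial ℕ := Classical.choose K.exists_hdrPoly

/-- `kind g, arity g, width g < 2^{H(|g|)}`. [cite: AroraBarak2009, §1.3] -/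
theorem lt_two_pow_hdrPoly (g : List Bool) :
    K.kind g < 2 ^ K.hdrPoly.eval g.length ∧ K.arity g < 2 ^ K.hdrPoly.eval g.length ∧
      K.width g < 2 ^ K.hdrPoly.eval g.length :=
  Classical.choose_spec K.exists_hdrPoly g

/-- The register bound `M(n) = 2^n + 2^{H(n)}` on inputs of length `n`. [cite: AroraBarak2009, §1.3] -/
def regBound (n : ℕ) : ℕ := 2 ^ n + 2 ^ K.hdrPoly.eval n

/-- On a gate of name length `≤ n`, the header values are `≤ M(n)`. [cite: AroraBarak2009, §1.3] -/
theorem hdr_le_regBound {n : ℕ} {g : List Bool} (hg : g.length ≤ n) :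
    K.kind g ≤ K.regBound n ∧ K.arity g ≤ K.regBound n ∧ K.width g ≤ K.regBound n := by
  obtain ⟨h1, h2, h3⟩ := K.lt_two_pow_hdrPoly g
  have hm : 2 ^ K.hdrPoly.eval g.length ≤ K.regBound n :=
    (Nat.pow_le_pow_right (by norm_num) (TM2Iter.eval_mono _ hg)).trans (Nat.le_add_left _ _)
  exact ⟨(le_of_lt h1).trans hm, (le_of_lt h2).trans hm, (le_of_lt h3).trans hm⟩

/-- **Well-formed register files at each program point** (the relations the loop measure and the
size bound need; `A = arity g`, `W = width g`). [cite: HomerSelman2011, Thm. 5.13 (proof, p. 97)] -/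
def PcOK (g : List Bool) (ρ : Regs) : Prop :=
  if ρ.pc = 0 then ρ.kd = 0 ∧ ρ.ar = 0 ∧ ρ.wd = 0 ∧ ρ.j = 0 ∧ ρ.ix = 0 ∧ ρ.col = 0 ∧ ρ.cy = 0 ∧ ρ.b = 0 ∧
    ρ.fl = 0 ∧ ρ.u = 0 ∧ ρ.ans = 0
  else if ρ.pc = 1 ∨ ρ.pc = 2 ∨ ρ.pc = 13 then ρ.fl = 0
  else if ρ.pc = 10 then K.kind g = 1 ∧ ρ.fl = 0
  else if ρ.pc = 11 then K.kind g = 1 ∧ ρ.j ≤ ρ.i ∧ ρ.ix ≤ K.arity g ∧ ρ.col ≤ ρ.ix ∧ ρ.cy ≤ K.arity g ∧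
    (ρ.fl = 1 → ρ.ix < K.arity g)
  else if ρ.pc = 12 then K.kind g = 1 ∧ ρ.j ≤ ρ.i ∧ ρ.col ≤ K.arity g ∧ ρ.cy ≤ K.arity g ∧ ρ.fl = 0
  else if ρ.pc = 20 then K.kind g = 2 ∧ ρ.fl = 0
  else if ρ.pc = 21 then K.kind g = 2 ∧ ρ.j ≤ ρ.i ∧ ρ.ix ≤ ρ.j + 1 ∧ ρ.col ≤ ρ.ix ∧ ρ.cy ≤ ρ.i + 1 ∧
    (ρ.fl = 1 → ρ.ix ≤ ρ.j)
  else if ρ.pc = 22 then K.kind g = 2 ∧ ρ.j ≤ ρ.i ∧ ρ.ix ≤ ρ.j ∧ ρ.col ≤ ρ.ix ∧ ρ.cy ≤ ρ.i + 1 ∧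
    (ρ.fl = 1 → ρ.u = 1)
  else if ρ.pc = 24 then K.kind g = 2 ∧ ρ.j ≤ ρ.i ∧ ρ.col ≤ ρ.j + 1 ∧ ρ.cy ≤ ρ.i + 1 ∧ ρ.fl = 0
  else if ρ.pc = 30 then K.kind g = 3 ∧ ρ.fl = 0
  else if ρ.pc = 31 then K.kind g = 3 ∧ ρ.j ≤ K.width g ∧ (ρ.fl = 1 → ρ.j < K.width g)
  else if ρ.pc = 32 then K.kind g = 3 ∧ ρ.j < K.width g
  else if ρ.pc = 35 ∨ ρ.pc = 36 then K.kind g = 3 ∧ ρ.j ≤ K.width g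
  else False

/-- **Well-formed activation records** on inputs of length `n`: short gate name, bounded registers,
cached header (past program point `0`), and the program-point relations. [cite: HomerSelman2011, Thm. 5.13 (proof, p. 97: "each activation record has size O(S(n))")] -/
def WF (n : ℕ) (g : List Bool) (ρ : Regs) : Prop :=
  g.length ≤ n ∧ ρ.i ≤ K.regBound n ∧ ρ.j ≤ K.regBound n + 1 ∧ ρ.ix ≤ K.regBound n + 1 ∧
    ρ.col ≤ K.regBound n + 1 ∧ ρ.cy ≤ K.regBound n + 1 ∧ ρ.b ≤ 1 ∧ ρ.fl ≤ 1 ∧ ρ.u ≤ 1 ∧ ρ.ans ≤ 1 ∧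
    (ρ.pc ≠ 0 → ρ.kd = K.kind g ∧ ρ.ar = K.arity g ∧ ρ.wd = K.width g) ∧ K.PcOK g ρ

/-- The envelope of the loop measure of a call "bit `i` of `g`". [cite: HomerSelman2011, Thm. 5.13 (proof, p. 97)] -/
def bigPot (g : List Bool) (i : ℕ) : ℕ := ((i + K.width g + 2) * (K.arity g + i + K.width g + 4)) * 8 + 64

/-- **The potential** (loop measure) of a register file: lexicographic in (columns left, terms left,
phase), flattened to one number; it drops at every own step of the record (continue, resume,
post-call update). [cite: HomerSelman2011, Thm. 5.13 (proof, p. 97)] -/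
def potF (g : List Bool) (ρ : Regs) : ℕ :=
  if ρ.pc = 0 then K.bigPot g ρ.i + 3
  else if ρ.pc = 1 then K.bigPot g ρ.i + 2
  else if ρ.pc = 10 ∨ ρ.pc = 20 ∨ ρ.pc = 30 then K.bigPot g ρ.i + 1
  else if ρ.pc = 11 then
    (ρ.i + 1 - ρ.j) * (K.arity g + 2) * 8 + (K.arity g + 1 - ρ.ix) * 8 + (if ρ.fl = 1 then 2 else 4)
  else if ρ.pc = 12 then (ρ.i + 1 - ρ.j) * (K.arity g + 2) * 8 + 1
  else if ρ.pc = 21 then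
    (ρ.i + 1 - ρ.j) * (ρ.i + 3) * 8 + (ρ.j + 2 - ρ.ix) * 8 + (if ρ.fl = 1 then 3 else 4)
  else if ρ.pc = 22 then
    (ρ.i + 1 - ρ.j) * (ρ.i + 3) * 8 + (ρ.j + 2 - ρ.ix) * 8 + (if ρ.fl = 1 then 1 else 2)
  else if ρ.pc = 24 then (ρ.i + 1 - ρ.j) * (ρ.i + 3) * 8 + 1
  else if ρ.pc = 31 then (K.width g + 1 - ρ.j) * 8 + (if ρ.fl = 1 then 5 else 6)
  else if ρ.pc = 32 then (K.width g + 1 - ρ.j) * 8 + (if ρ.fl = 1 then 3 else 4)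
  else if ρ.pc = 35 ∨ ρ.pc = 36 then (if ρ.fl = 1 then 1 else 2)
  else 0

variable {K}

/-- The program points of a well-formed record. [folklore] -/
private theorem pc_cases {g : List Bool} {ρ : Regs} (h : K.PcOK g ρ) :
    ρ.pc = 0 ∨ ρ.pc = 1 ∨ ρ.pc = 2 ∨ ρ.pc = 13 ∨ ρ.pc = 10 ∨ ρ.pc = 11 ∨ ρ.pc = 12 ∨ ρ.pc = 20 ∨ ρ.pc = 21 ∨
      ρ.pc = 22 ∨ ρ.pc = 24 ∨ ρ.pc = 30 ∨ ρ.pc = 31 ∨ ρ.pc = 32 ∨ ρ.pc = 35 ∨ ρ.pc = 36 := by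
  by_contra hne
  simp only [not_or] at hne
  obtain ⟨h0, h1, h2, h13, h10, h11, h12, h20, h21, h22, h24, h30, h31, h32, h35, h36⟩ := hne
  simp only [PcOK, h0, h1, h2, h13, h10, h11, h12, h20, h21, h22, h24, h30, h31, h32, h35, h36, if_false,
    or_self] at h

/-- The potential stays below its envelope. [cite: HomerSelman2011, Thm. 5.13 (proof, p. 97)] -/
theorem potF_le {n : ℕ} {g : List Bool} {ρ : Regs} (h : K.WF n g ρ) : K.potF g ρ ≤ K.bigPot g ρ.i + 3 := by
  obtain ⟨-, -, -, -, -, -, -, -, -, -, -, hP⟩ := h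
  have hpc := pc_cases hP
  have e1 : (ρ.i + 2) * (K.arity g + 2) ≤ (ρ.i + K.width g + 2) * (K.arity g + ρ.i + K.width g + 4) :=
    Nat.mul_le_mul (by omega) (by omega)
  have e2 : (ρ.i + 2) * (ρ.i + 4) ≤ (ρ.i + K.width g + 2) * (K.arity g + ρ.i + K.width g + 4) :=
    Nat.mul_le_mul (by omega) (by omega)
  have e3 : K.width g + 1 ≤ (ρ.i + K.width g + 2) * (K.arity g + ρ.i + K.width g + 4) :=
    le_trans (by omega) (Nat.le_mul_of_pos_right _ (by omega))
  unfold PcOK at hP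
  unfold potF bigPot
  rcases hpc with h | h | h | h | h | h | h | h | h | h | h | h | h | h | h | h <;>
    simp only [h] at hP ⊢ <;> norm_num at hP ⊢ <;> try omega
  · -- 11
    have a1 : (ρ.i + 1 - ρ.j) * (K.arity g + 2) ≤ (ρ.i + 1) * (K.arity g + 2) := Nat.mul_le_mul (by omega) le_rfl
    have a2 : (ρ.i + 1) * (K.arity g + 2) + (K.arity g + 2) = (ρ.i + 2) * (K.arity g + 2) := by ring
    split_ifs <;> omega
  · -- 12
    have a1 : (ρ.i + 1 - ρ.j) * (K.arity g + 2) ≤ (ρ.i + 1) * (K.arity g + 2) := Nat.mul_le_mul (by omega) le_rfl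
    have a2 : (ρ.i + 1) * (K.arity g + 2) + (K.arity g + 2) = (ρ.i + 2) * (K.arity g + 2) := by ring
    omega
  · -- 21
    have a1 : (ρ.i + 1 - ρ.j) * (ρ.i + 3) ≤ (ρ.i + 1) * (ρ.i + 3) := Nat.mul_le_mul (by omega) le_rfl
    have a2 : (ρ.i + 2) * (ρ.i + 4) = (ρ.i + 1) * (ρ.i + 3) + (ρ.i + 3) + (ρ.i + 2) := by ring
    split_ifs <;> omega
  · -- 22
    have a1 : (ρ.i + 1 - ρ.j) * (ρ.i + 3) ≤ (ρ.i + 1) * (ρ.i + 3) := Nat.mul_le_mul (by omega) le_rfl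
    have a2 : (ρ.i + 2) * (ρ.i + 4) = (ρ.i + 1) * (ρ.i + 3) + (ρ.i + 3) + (ρ.i + 2) := by ring
    split_ifs <;> omega
  · -- 24
    have a1 : (ρ.i + 1 - ρ.j) * (ρ.i + 3) ≤ (ρ.i + 1) * (ρ.i + 3) := Nat.mul_le_mul (by omega) le_rfl
    have a2 : (ρ.i + 2) * (ρ.i + 4) = (ρ.i + 1) * (ρ.i + 3) + (ρ.i + 3) + (ρ.i + 2) := by ring
    omega
  · -- 31
    split_ifs <;> omega
  · -- 32
    split_ifs <;> omega
  · -- 35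
    split_ifs <;> omega
  · -- 36
    split_ifs <;> omega

/-- The resumed record (returned bit stored, flag raised). [cite: HomerSelman2011, Thm. 5.13 (proof, p. 97)] -/
def Regs.resumed (ρ : Regs) (bit : Bool) : Regs :=
  ⟨ρ.pc, ρ.i, ρ.kd, ρ.ar, ρ.wd, ρ.j, ρ.ix, ρ.col, ρ.cy, if bit then 1 else 0, 1, ρ.u, ρ.ans⟩

/-- Resumption is the `resumed` update. [cite: HomerSelman2011, Thm. 5.13 (proof, p. 97)] -/
theorem resumeSem_toList (g : List Bool) (ρ : Regs) (bit : Bool) :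
    resumeSem (g, ρ.toList) bit = (g, (ρ.resumed bit).toList) := rfl

/-- **What one step of a well-formed record may do**: CONTINUE to a well-formed record of smaller
potential; CALL an in-range child on a bit `≤ M(n)`, the record resumed with any returned bit being
well formed of smaller potential; RETURN one bit. [cite: HomerSelman2011, Thm. 5.13 (proof, p. 97)] -/
def Progress (n : ℕ) (g : List Bool) (ρ : Regs) : Prop :=
  (∃ ρ' : Regs, K.stepSem (g, ρ.toList) = .cont (g, ρ'.toList) ∧ K.WF n g ρ' ∧ K.potF g ρ' < K.potF g ρ) ∨
    (∃ k t, k < gateFanIn (K.kind g) (K.arity g) ∧ K.stepSem (g, ρ.toList) = .call (K.child g k, initRegs t) ∧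
      t ≤ K.regBound n ∧ ∀ bit : Bool, K.WF n g (ρ.resumed bit) ∧ K.potF g (ρ.resumed bit) < K.potF g ρ) ∨
    (∃ bit : Bool, K.stepSem (g, ρ.toList) = .ret [bit])

section ProgressLemmas

variable {n : ℕ} {g : List Bool} {ρ : Regs}

/-- Envelope inequality for the sum loop head. [folklore] -/
private theorem env1 (i A W : ℕ) : (i + 1) * (A + 2) + (A + 2) ≤ (i + W + 2) * (A + i + W + 4) :=
  le_trans (le_of_eq (by ring)) (Nat.mul_le_mul (by omega : i + 2 ≤ i + W + 2) (by omega : A + 2 ≤ A + i + W + 4))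

/-- Envelope inequality for the product loop head. [folklore] -/
private theorem env2 (i A W : ℕ) : (i + 1) * (i + 3) + (i + 3) + (i + 2) ≤ (i + W + 2) * (A + i + W + 4) :=
  le_trans (le_of_eq (by ring)) (Nat.mul_le_mul (by omega : i + 2 ≤ i + W + 2) (by omega : i + 4 ≤ A + i + W + 4))

/-- Envelope inequality for the select loop head. [folklore] -/
private theorem env3 (i A W : ℕ) : W + 1 ≤ (i + W + 2) * (A + i + W + 4) :=
  le_trans (by omega) (Nat.le_mul_of_pos_right _ (by omega))

/-- Progress at program point `0`. [cite: KoiranPerifel2009VPSPACE, §3.2, Prop. 1 (proof)] -/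
private theorem prog0 (hW : K.WF n g ρ) (h : ρ.pc = 0) : K.Progress n g ρ := by
  obtain ⟨hg, hi, hj, hix, hcol, hcy, hb, hfl, hu, hans, hhdr, hP⟩ := hW
  simp only [PcOK, h] at hP; norm_num at hP
  refine Or.inl ⟨_, K.stepSem_pc0 g ρ (by omega) h, ?_, ?_⟩
  · norm_num [WF, PcOK] ; omega
  · norm_num [potF, h]

/-- Progress at program point `1`. [cite: KoiranPerifel2009VPSPACE, §3.2, Prop. 1 (proof)] -/
private theorem prog1 (hW : K.WF n g ρ) (h : ρ.pc = 1) : K.Progress n g ρ := by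
  obtain ⟨hg, hi, hj, hix, hcol, hcy, hb, hfl, hu, hans, hhdr, hP⟩ := hW
  obtain ⟨hMk, hMa, hMw⟩ := K.hdr_le_regBound hg
  simp only [PcOK, h] at hP; norm_num at hP
  obtain ⟨hkd, har, hwd⟩ := hhdr (by omega)
  refine Or.inl ⟨_, K.stepSem_pc1 g ρ (by omega) h, ?_, ?_⟩
  · by_cases k1 : K.kind g = 1
    · norm_num [WF, PcOK, hkd, k1] ; omega
    · by_cases k2 : K.kind g = 2
      · norm_num [WF, PcOK, hkd, k2] ; omega
      · by_cases k3 : K.kind g = 3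
        · norm_num [WF, PcOK, hkd, k3] ; omega
        · norm_num [WF, PcOK, hkd, k1, k2, k3] ; omega
  · by_cases k1 : K.kind g = 1
    · norm_num [potF, hkd, k1, h]
    · by_cases k2 : K.kind g = 2
      · norm_num [potF, hkd, k2, h]
      · by_cases k3 : K.kind g = 3
        · norm_num [potF, hkd, k3, h]
        · norm_num [potF, hkd, k1, k2, k3, h]

/-- Progress at program points `2` and `13` (returns). [cite: KoiranPerifel2009VPSPACE, §3.2, Prop. 1 (proof)] -/
private theorem prog2_13 (hW : K.WF n g ρ) (h : ρ.pc = 2 ∨ ρ.pc = 13) : K.Progress n g ρ := by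
  obtain ⟨-, -, -, -, -, -, -, -, -, -, -, hP⟩ := hW
  rcases h with h | h <;> (simp only [PcOK, h] at hP; norm_num at hP)
  · exact Or.inr (Or.inr ⟨_, K.stepSem_pc2 g ρ (by omega) h⟩)
  · exact Or.inr (Or.inr ⟨_, K.stepSem_pc13 g ρ (by omega) h⟩)

/-- Progress at the loop heads `10`, `20`, `30`. [cite: KnuthTAOCP2, §4.3.1, Algorithms A (A1), M (M1)] -/
private theorem prog10_20_30 (hW : K.WF n g ρ) (h : ρ.pc = 10 ∨ ρ.pc = 20 ∨ ρ.pc = 30) : K.Progress n g ρ := by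
  obtain ⟨hg, hi, hj, hix, hcol, hcy, hb, hfl, hu, hans, hhdr, hP⟩ := hW
  obtain ⟨hMk, hMa, hMw⟩ := K.hdr_le_regBound hg
  have e1 := env1 ρ.i (K.arity g) (K.width g)
  have e2 := env2 ρ.i (K.arity g) (K.width g)
  have e3 := env3 ρ.i (K.arity g) (K.width g)
  rcases h with h | h | h <;> (simp only [PcOK, h] at hP; norm_num at hP) <;> obtain ⟨hkd, har, hwd⟩ := hhdr (by omega)
  · refine Or.inl ⟨_, K.stepSem_pc10 g ρ (by omega) h, ?_, ?_⟩
    · norm_num [WF, PcOK] ; omega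
    · have hf : ρ.fl = 0 := by omega
      norm_num [potF, bigPot, h, hf] ; omega
  · refine Or.inl ⟨_, K.stepSem_pc20 g ρ (by omega) h, ?_, ?_⟩
    · norm_num [WF, PcOK] ; omega
    · have hf : ρ.fl = 0 := by omega
      norm_num [potF, bigPot, h, hf] ; omega
  · refine Or.inl ⟨_, K.stepSem_pc30 g ρ (by omega) h, ?_, ?_⟩
    · norm_num [WF, PcOK] ; omega
    · have hf : ρ.fl = 0 := by omega
      norm_num [potF, bigPot, h, hf] ; omega

/-- Progress at `11` (sum, inside a column). [cite: KnuthTAOCP2, §4.3.1, Algorithm A (A2)] -/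
private theorem prog11 (hW : K.WF n g ρ) (h : ρ.pc = 11) : K.Progress n g ρ := by
  obtain ⟨hg, hi, hj, hix, hcol, hcy, hb, hfl, hu, hans, hhdr, hP⟩ := hW
  obtain ⟨hMk, hMa, hMw⟩ := K.hdr_le_regBound hg
  simp only [PcOK, h] at hP; norm_num at hP
  obtain ⟨hkd, har, hwd⟩ := hhdr (by omega)
  obtain ⟨k1, hji, hixA, hcolix, hcyA, hflix⟩ := hP
  rcases Nat.lt_or_ge ρ.fl 1 with hf0 | hf1
  · have hf : ρ.fl = 0 := by omega
    by_cases hlt : ρ.ix < ρ.ar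
    · refine Or.inr (Or.inl ⟨ρ.ix, ρ.j, ?_, K.stepSem_pc11_call g ρ (by omega) h hlt, by omega, fun bit => ⟨?_, ?_⟩⟩)
      · simp only [gateFanIn, k1, if_true]; omega
      · cases bit <;> (norm_num [WF, PcOK, Regs.resumed, h] ; omega)
      · cases bit <;> (norm_num [potF, Regs.resumed, h, hf])
    · refine Or.inl ⟨_, K.stepSem_pc11_done g ρ (by omega) h hlt, ?_, ?_⟩
      · norm_num [WF, PcOK] ; omega
      · norm_num [potF, h, hf] ; omega
  · have hf : ρ.fl = 1 := by omega
    refine Or.inl ⟨_, K.stepSem_post11 g ρ hf h, ?_, ?_⟩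
    · norm_num [WF, PcOK] ; omega
    · norm_num [potF, h, hf] ; omega

/-- Progress at `12` (sum, end of a column). [cite: KnuthTAOCP2, §4.3.1, Algorithm A (A2–A3)] -/
private theorem prog12 (hW : K.WF n g ρ) (h : ρ.pc = 12) : K.Progress n g ρ := by
  obtain ⟨hg, hi, hj, hix, hcol, hcy, hb, hfl, hu, hans, hhdr, hP⟩ := hW
  obtain ⟨hMk, hMa, hMw⟩ := K.hdr_le_regBound hg
  simp only [PcOK, h] at hP; norm_num at hP
  obtain ⟨hkd, har, hwd⟩ := hhdr (by omega)
  obtain ⟨k1, hji, hcolA, hcyA, hf⟩ := hP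
  by_cases hlast : ρ.j = ρ.i
  · refine Or.inl ⟨_, K.stepSem_pc12_24_last g ρ (by omega) (Or.inl h) hlast, ?_, ?_⟩
    · norm_num [WF, PcOK] ; omega
    · norm_num [potF, h]
  · refine Or.inl ⟨_, K.stepSem_pc12_next g ρ (by omega) h hlast, ?_, ?_⟩
    · norm_num [WF, PcOK] ; omega
    · have a : (ρ.i + 1 - ρ.j) * (K.arity g + 2) = (ρ.i - ρ.j) * (K.arity g + 2) + (K.arity g + 2) := by
        rw [show ρ.i + 1 - ρ.j = (ρ.i - ρ.j) + 1 by omega]; ring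
      have a' : ρ.i + 1 - (ρ.j + 1) = ρ.i - ρ.j := by omega
      norm_num [potF, h, hf, a'] ; omega

/-- Progress at `21` (product, inside a column). [cite: KnuthTAOCP2, §4.3.1, Algorithm M (M3)] -/
private theorem prog21 (hW : K.WF n g ρ) (h : ρ.pc = 21) : K.Progress n g ρ := by
  obtain ⟨hg, hi, hj, hix, hcol, hcy, hb, hfl, hu, hans, hhdr, hP⟩ := hW
  obtain ⟨hMk, hMa, hMw⟩ := K.hdr_le_regBound hg
  simp only [PcOK, h] at hP; norm_num at hP
  obtain ⟨hkd, har, hwd⟩ := hhdr (by omega)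
  obtain ⟨k2, hji, hixj, hcolix, hcyi, hflix⟩ := hP
  rcases Nat.lt_or_ge ρ.fl 1 with hf0 | hf1
  · have hf : ρ.fl = 0 := by omega
    by_cases hle : ρ.ix ≤ ρ.j
    · refine Or.inr (Or.inl ⟨0, ρ.ix, ?_, K.stepSem_pc21_call g ρ (by omega) h hle, by omega, fun bit => ⟨?_, ?_⟩⟩)
      · norm_num [gateFanIn, k2]
      · cases bit <;> (norm_num [WF, PcOK, Regs.resumed, h] ; omega)
      · cases bit <;> (norm_num [potF, Regs.resumed, h, hf])
    · refine Or.inl ⟨_, K.stepSem_pc21_done g ρ (by omega) h hle, ?_, ?_⟩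
      · norm_num [WF, PcOK] ; omega
      · norm_num [potF, h, hf] ; omega
  · have hf : ρ.fl = 1 := by omega
    refine Or.inl ⟨_, K.stepSem_post21 g ρ hf h, ?_, ?_⟩
    · norm_num [WF, PcOK] ; omega
    · norm_num [potF, h, hf]

/-- Progress at `22` (product, second factor's bit). [cite: KnuthTAOCP2, §4.3.1, Algorithm M (M4)] -/
private theorem prog22 (hW : K.WF n g ρ) (h : ρ.pc = 22) : K.Progress n g ρ := by
  obtain ⟨hg, hi, hj, hix, hcol, hcy, hb, hfl, hu, hans, hhdr, hP⟩ := hW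
  obtain ⟨hMk, hMa, hMw⟩ := K.hdr_le_regBound hg
  simp only [PcOK, h] at hP; norm_num at hP
  obtain ⟨hkd, har, hwd⟩ := hhdr (by omega)
  obtain ⟨k2, hji, hixj, hcolix, hcyi, hflu⟩ := hP
  rcases Nat.lt_or_ge ρ.fl 1 with hf0 | hf1
  · have hf : ρ.fl = 0 := by omega
    by_cases hu1 : ρ.u = 1
    · refine Or.inr (Or.inl ⟨1, ρ.j - ρ.ix, ?_, K.stepSem_pc22_call g ρ (by omega) h hu1, by omega,
        fun bit => ⟨?_, ?_⟩⟩)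
      · norm_num [gateFanIn, k2]
      · cases bit <;> (norm_num [WF, PcOK, Regs.resumed, h] ; omega)
      · cases bit <;> (norm_num [potF, Regs.resumed, h, hf])
    · refine Or.inl ⟨_, K.stepSem_pc22_skip g ρ (by omega) h hu1, ?_, ?_⟩
      · norm_num [WF, PcOK] ; omega
      · norm_num [potF, h, hf] ; omega
  · have hf : ρ.fl = 1 := by omega
    refine Or.inl ⟨_, K.stepSem_post22 g ρ hf h, ?_, ?_⟩
    · norm_num [WF, PcOK] ; omega
    · norm_num [potF, h, hf] ; omega

/-- Progress at `24` (product, end of a column). [cite: KnuthTAOCP2, §4.3.1, Algorithm M (M5–M6)] -/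
private theorem prog24 (hW : K.WF n g ρ) (h : ρ.pc = 24) : K.Progress n g ρ := by
  obtain ⟨hg, hi, hj, hix, hcol, hcy, hb, hfl, hu, hans, hhdr, hP⟩ := hW
  obtain ⟨hMk, hMa, hMw⟩ := K.hdr_le_regBound hg
  simp only [PcOK, h] at hP; norm_num at hP
  obtain ⟨hkd, har, hwd⟩ := hhdr (by omega)
  obtain ⟨k2, hji, hcolj, hcyi, hf⟩ := hP
  by_cases hlast : ρ.j = ρ.i
  · refine Or.inl ⟨_, K.stepSem_pc12_24_last g ρ (by omega) (Or.inr h) hlast, ?_, ?_⟩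
    · norm_num [WF, PcOK] ; omega
    · norm_num [potF, h]
  · refine Or.inl ⟨_, K.stepSem_pc24_next g ρ (by omega) h hlast, ?_, ?_⟩
    · norm_num [WF, PcOK] ; omega
    · have a : (ρ.i + 1 - ρ.j) * (ρ.i + 3) = (ρ.i - ρ.j) * (ρ.i + 3) + (ρ.i + 3) := by
        rw [show ρ.i + 1 - ρ.j = (ρ.i - ρ.j) + 1 by omega]; ring
      have a' : ρ.i + 1 - (ρ.j + 1) = ρ.i - ρ.j := by omega
      norm_num [potF, h, hf, a'] ; omega

/-- Progress at `31` (select, comparing bit `j`). [cite: KoiranPerifel2009VPSPACE, §3.2] -/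
private theorem prog31 (hW : K.WF n g ρ) (h : ρ.pc = 31) : K.Progress n g ρ := by
  obtain ⟨hg, hi, hj, hix, hcol, hcy, hb, hfl, hu, hans, hhdr, hP⟩ := hW
  obtain ⟨hMk, hMa, hMw⟩ := K.hdr_le_regBound hg
  simp only [PcOK, h] at hP; norm_num at hP
  obtain ⟨hkd, har, hwd⟩ := hhdr (by omega)
  obtain ⟨k3, hjW, hfljW⟩ := hP
  rcases Nat.lt_or_ge ρ.fl 1 with hf0 | hf1
  · have hf : ρ.fl = 0 := by omega
    by_cases hlt : ρ.j < ρ.wd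
    · refine Or.inr (Or.inl ⟨0, ρ.j, ?_, K.stepSem_pc31_call g ρ (by omega) h hlt, by omega, fun bit => ⟨?_, ?_⟩⟩)
      · norm_num [gateFanIn, k3]
      · cases bit <;> (norm_num [WF, PcOK, Regs.resumed, h] ; omega)
      · cases bit <;> (norm_num [potF, Regs.resumed, h, hf])
    · refine Or.inl ⟨_, K.stepSem_pc31_done g ρ (by omega) h hlt, ?_, ?_⟩
      · norm_num [WF, PcOK] ; omega
      · norm_num [potF, h, hf]
  · have hf : ρ.fl = 1 := by omega
    refine Or.inl ⟨_, K.stepSem_post31 g ρ hf h, ?_, ?_⟩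
    · norm_num [WF, PcOK] ; omega
    · norm_num [potF, h, hf]

/-- Progress at `32` (select, second compared bit). [cite: KoiranPerifel2009VPSPACE, §3.2] -/
private theorem prog32 (hW : K.WF n g ρ) (h : ρ.pc = 32) : K.Progress n g ρ := by
  obtain ⟨hg, hi, hj, hix, hcol, hcy, hb, hfl, hu, hans, hhdr, hP⟩ := hW
  obtain ⟨hMk, hMa, hMw⟩ := K.hdr_le_regBound hg
  simp only [PcOK, h] at hP; norm_num at hP
  obtain ⟨hkd, har, hwd⟩ := hhdr (by omega)
  obtain ⟨k3, hjW⟩ := hP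
  rcases Nat.lt_or_ge ρ.fl 1 with hf0 | hf1
  · have hf : ρ.fl = 0 := by omega
    refine Or.inr (Or.inl ⟨1, ρ.j, ?_, K.stepSem_pc32 g ρ (by omega) h, by omega, fun bit => ⟨?_, ?_⟩⟩)
    · norm_num [gateFanIn, k3]
    · cases bit <;> (norm_num [WF, PcOK, Regs.resumed, h] ; omega)
    · cases bit <;> (norm_num [potF, Regs.resumed, h, hf])
  · have hf : ρ.fl = 1 := by omega
    by_cases hbu : ρ.b = ρ.u
    · refine Or.inl ⟨⟨31, ρ.i, ρ.kd, ρ.ar, ρ.wd, ρ.j + 1, ρ.ix, ρ.col, ρ.cy, ρ.b, 0, ρ.u, ρ.ans⟩, ?_, ?_, ?_⟩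
      · rw [K.stepSem_post32 g ρ hf h]; simp only [hbu, if_true]
      · norm_num [WF, PcOK] ; omega
      · have a' : K.width g + 1 - (ρ.j + 1) = K.width g - ρ.j := by omega
        norm_num [potF, h, hf, a'] ; omega
    · refine Or.inl ⟨⟨36, ρ.i, ρ.kd, ρ.ar, ρ.wd, ρ.j, ρ.ix, ρ.col, ρ.cy, ρ.b, 0, ρ.u, ρ.ans⟩, ?_, ?_, ?_⟩
      · rw [K.stepSem_post32 g ρ hf h]; simp only [hbu, if_false]
      · norm_num [WF, PcOK] ; omega
      · norm_num [potF, h, hf]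

/-- Progress at `35` / `36` (select, tail calls). [cite: KoiranPerifel2009VPSPACE, §3.2] -/
private theorem prog35_36 (hW : K.WF n g ρ) (h : ρ.pc = 35 ∨ ρ.pc = 36) : K.Progress n g ρ := by
  obtain ⟨hg, hi, hj, hix, hcol, hcy, hb, hfl, hu, hans, hhdr, hP⟩ := hW
  obtain ⟨hMk, hMa, hMw⟩ := K.hdr_le_regBound hg
  have hP' : K.kind g = 3 ∧ ρ.j ≤ K.width g := by
    rcases h with h | h <;> (simp only [PcOK, h] at hP; norm_num at hP) <;> exact hP
  obtain ⟨k3, hjW⟩ := hP'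
  obtain ⟨hkd, har, hwd⟩ := hhdr (by omega)
  rcases Nat.lt_or_ge ρ.fl 1 with hf0 | hf1
  · have hf : ρ.fl = 0 := by omega
    rcases h with h | h
    · refine Or.inr (Or.inl ⟨2, ρ.i, ?_, K.stepSem_pc35 g ρ (by omega) h, by omega, fun bit => ⟨?_, ?_⟩⟩)
      · norm_num [gateFanIn, k3]
      · cases bit <;> (norm_num [WF, PcOK, Regs.resumed, h] ; omega)
      · cases bit <;> norm_num [potF, Regs.resumed, h, hf]
    · refine Or.inr (Or.inl ⟨3, ρ.i, ?_, K.stepSem_pc36 g ρ (by omega) h, by omega, fun bit => ⟨?_, ?_⟩⟩)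
      · norm_num [gateFanIn, k3]
      · cases bit <;> (norm_num [WF, PcOK, Regs.resumed, h] ; omega)
      · cases bit <;> norm_num [potF, Regs.resumed, h, hf]
  · have hf : ρ.fl = 1 := by omega
    refine Or.inl ⟨_, K.stepSem_post35_36 g ρ hf h, ?_, ?_⟩
    · norm_num [WF, PcOK] ; omega
    · rcases h with h | h <;> norm_num [potF, h, hf]

end ProgressLemmas

/-- **Progress of well-formed records.** [cite: HomerSelman2011, Thm. 5.13 (proof, p. 97)] [cite: KnuthTAOCP2, §4.3.1, Algorithms A, M] -/
theorem wf_progress {n : ℕ} {g : List Bool} {ρ : Regs} (hW : K.WF n g ρ) : K.Progress n g ρ := by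
  rcases pc_cases hW.2.2.2.2.2.2.2.2.2.2.2 with h | h | h | h | h | h | h | h | h | h | h | h | h | h | h | h
  · exact prog0 hW h
  · exact prog1 hW h
  · exact prog2_13 hW (Or.inl h)
  · exact prog2_13 hW (Or.inr h)
  · exact prog10_20_30 hW (Or.inl h)
  · exact prog11 hW h
  · exact prog12 hW h
  · exact prog10_20_30 hW (Or.inr (Or.inl h))
  · exact prog21 hW h
  · exact prog22 hW h
  · exact prog24 hW h
  · exact prog10_20_30 hW (Or.inr (Or.inr h))
  · exact prog31 hW h
  · exact prog32 hW h
  · exact prog35_36 hW (Or.inl h)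
  · exact prog35_36 hW (Or.inr h)

/-! ### Assembling the certificate -/

/-- The gate name is the first component of a record's code. [cite: AroraBarak2009, §0.1] -/
theorem fstF_frameE (g : List Bool) (r : List ℕ) : fstF (frameE (g, r)) = g := by
  simp [frameE, pairE, strE]

/-- Register records are determined by their register files. [cite: HomerSelman2011, Thm. 5.13 (proof, p. 97)] -/
theorem Regs.toList_injective : Function.Injective Regs.toList := by
  rintro ⟨_, _, _, _, _, _, _, _, _, _, _, _, _⟩ ⟨_, _, _, _, _, _, _, _, _, _, _, _, _⟩ h
  simp only [Regs.toList, List.cons.injEq, and_true] at h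
  obtain ⟨rfl, rfl, rfl, rfl, rfl, rfl, rfl, rfl, rfl, rfl, rfl, rfl, rfl⟩ := h
  rfl

/-- **The invariant of the run**: codes of well-formed records. [cite: HomerSelman2011, Thm. 5.13 (proof, p. 97)] -/
def Inv (w f : List Bool) : Prop := ∃ (g : List Bool) (ρ : Regs), f = frameE (g, ρ.toList) ∧ K.WF w.length g ρ

/-- **The rank** of a record: the depth of its gate. [cite: HomerSelman2011, Thm. 5.13 (proof, p. 97: "each successive call decrements")] -/
def rkF (f : List Bool) : ℕ := K.depth (fstF f)

/-- Decoding the code of a record (by choice; junk off codes). [cite: AroraBarak2009, §0.1] -/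
def decF (f : List Bool) : List Bool × Regs :=
  @Classical.epsilon (List Bool × Regs) ⟨([], ⟨0, 0, 0, 0, 0, 0, 0, 0, 0, 0, 0, 0, 0⟩)⟩
    (fun x => f = frameE (x.1, x.2.toList))

/-- Decoding the code of a record gives the record back. [cite: AroraBarak2009, §0.1] -/
theorem decF_frameE (g : List Bool) (ρ : Regs) : decF (frameE (g, ρ.toList)) = (g, ρ) := by
  unfold decF
  have hx := Classical.epsilon_spec (p := fun x : List Bool × Regs => frameE (g, ρ.toList) = frameE (x.1, x.2.toList))
    ⟨(g, ρ), rfl⟩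
  have h1 := frameE_injective hx
  simp only [Prod.mk.injEq] at h1
  obtain ⟨h1a, h1b⟩ := h1
  ext1
  · exact h1a.symm
  · exact (Regs.toList_injective h1b).symm

/-- **The potential** of a record (read through its code). [cite: HomerSelman2011, Thm. 5.13 (proof, p. 97)] -/
def potW (f : List Bool) : ℕ := K.potF (decF f).1 (decF f).2

/-- The potential of the code of a record is the record's potential. [cite: HomerSelman2011, Thm. 5.13 (proof, p. 97)] -/
theorem potW_frameE (g : List Bool) (ρ : Regs) : K.potW (frameE (g, ρ.toList)) = K.potF g ρ := by
  rw [potW, decF_frameE]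

/-- The rank of the code of a record is the depth of its gate. [cite: HomerSelman2011, Thm. 5.13 (proof, p. 97)] -/
theorem rkF_frameE (g : List Bool) (r : List ℕ) : K.rkF (frameE (g, r)) = K.depth g := by
  rw [rkF, fstF_frameE]

/-- The exponent `E(n) = n + H(n)`: every register of a well-formed record is `< 2^{E+6}`. [folklore] -/
private theorem reg_lt {n : ℕ} {g : List Bool} {ρ : Regs} (h : K.WF n g ρ) :
    ∀ r ∈ ρ.toList, r < 2 ^ (n + K.hdrPoly.eval n + 6) := by
  obtain ⟨hg, hi, hj, hix, hcol, hcy, hb, hfl, hu, hans, hhdr, hP⟩ := h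
  obtain ⟨hMk, hMa, hMw⟩ := K.hdr_le_regBound hg
  have h1 : 2 ^ n ≤ 2 ^ (n + K.hdrPoly.eval n) := Nat.pow_le_pow_right (by norm_num) (by omega)
  have h2 : 2 ^ K.hdrPoly.eval n ≤ 2 ^ (n + K.hdrPoly.eval n) := Nat.pow_le_pow_right (by norm_num) (by omega)
  have h3 : 2 ^ (n + K.hdrPoly.eval n + 6) = 2 ^ (n + K.hdrPoly.eval n) * 64 := by rw [pow_add]; norm_num
  have hM : K.regBound n + 40 < 2 ^ (n + K.hdrPoly.eval n + 6) := by
    rw [h3]; unfold regBound; have := Nat.one_le_two_pow (n := n + K.hdrPoly.eval n); omega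
  have hpc := pc_cases hP
  -- the cached header registers: `0` at program point `0`, else the true header
  have hhd : ρ.kd ≤ K.regBound n ∧ ρ.ar ≤ K.regBound n ∧ ρ.wd ≤ K.regBound n := by
    by_cases h0 : ρ.pc = 0
    · simp only [PcOK, h0, if_true] at hP; omega
    · obtain ⟨e1, e2, e3⟩ := hhdr h0; rw [e1, e2, e3]; exact ⟨hMk, hMa, hMw⟩
  intro r hr
  simp only [Regs.toList, List.mem_cons, List.not_mem_nil, or_false] at hr
  rcases hr with rfl | rfl | rfl | rfl | rfl | rfl | rfl | rfl | rfl | rfl | rfl | rfl | rfl <;> omega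

/-- **The size polynomial** `S = 28 X + 26 H + 184`. [cite: HomerSelman2011, Thm. 5.13 (proof, p. 97: "each activation record has size O(S(n))")] -/
def sizePoly : Polynomial ℕ := C 28 * X + C 26 * K.hdrPoly + C 184

/-- **Well-formed records are polynomially short.** [cite: HomerSelman2011, Thm. 5.13 (proof, p. 97)] -/
theorem length_frameE_le {n : ℕ} {g : List Bool} {ρ : Regs} (h : K.WF n g ρ) :
    (frameE (g, ρ.toList)).length ≤ K.sizePoly.eval n := by
  have hg : g.length ≤ n := h.1
  have hr := reg_lt h
  have hlen : ∀ r ∈ ρ.toList, (natE r).length ≤ n + K.hdrPoly.eval n + 6 := fun r hr' =>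
    (length_encodeNat_le_iff _ _).2 (hr r hr')
  have hraw : (regsE ρ.toList).length ≤ 13 * (2 * (n + K.hdrPoly.eval n + 6) + 2) := by
    rw [regsE, length_rawE]
    calc (ρ.toList.map fun a => 2 * (natE a).length + 2).sum
        ≤ (ρ.toList.map fun a => 2 * (natE a).length + 2).length • (2 * (n + K.hdrPoly.eval n + 6) + 2) :=
          List.sum_le_card_nsmul _ _ fun x hx => by
            obtain ⟨r, hr', rfl⟩ := List.mem_map.1 hx
            have := hlen r hr'
            omega
      _ = 13 * (2 * (n + K.hdrPoly.eval n + 6) + 2) := by rw [List.length_map]; rfl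
  have hpair : (frameE (g, ρ.toList)).length = 2 * g.length + 2 + (regsE ρ.toList).length := by
    simp [frameE, pairE, strE, length_boolPair]
  rw [hpair, sizePoly, eval_add, eval_add, eval_mul, eval_mul, eval_C, eval_C, eval_X, eval_C]
  omega

/-- **The potential polynomial** `r = 2 (X + H) + 11`: potentials are `< 2^{r}`. [cite: HomerSelman2011, Thm. 5.13 (proof, p. 97)] -/
def potPoly : Polynomial ℕ := C 2 * (X + K.hdrPoly) + C 11

/-- **Potentials of well-formed records are `< 2^{r(n)}`.** [cite: HomerSelman2011, Thm. 5.13 (proof, p. 97)] -/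
theorem potF_lt {n : ℕ} {g : List Bool} {ρ : Regs} (h : K.WF n g ρ) : K.potF g ρ < 2 ^ K.potPoly.eval n := by
  have hle := potF_le h
  obtain ⟨hg, hi, -⟩ := h
  obtain ⟨hMk, hMa, hMw⟩ := K.hdr_le_regBound hg
  set E := n + K.hdrPoly.eval n with hE
  have h1 : 2 ^ n ≤ 2 ^ E := Nat.pow_le_pow_right (by norm_num) (by omega)
  have h2 : 2 ^ K.hdrPoly.eval n ≤ 2 ^ E := Nat.pow_le_pow_right (by norm_num) (by omega)
  have hP : 1 ≤ 2 ^ E := Nat.one_le_two_pow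
  have hM : K.regBound n ≤ 2 * 2 ^ E := by unfold regBound; omega
  have hA : ρ.i + K.width g + 2 ≤ 8 * 2 ^ E := by omega
  have hB : K.arity g + ρ.i + K.width g + 4 ≤ 16 * 2 ^ E := by omega
  have hAB : (ρ.i + K.width g + 2) * (K.arity g + ρ.i + K.width g + 4) ≤ (8 * 2 ^ E) * (16 * 2 ^ E) :=
    Nat.mul_le_mul hA hB
  have hpow : 2 ^ K.potPoly.eval n = 2048 * (2 ^ E * 2 ^ E) := by
    rw [potPoly, eval_add, eval_mul, eval_C, eval_add, eval_X, eval_C, ← hE,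
      show 2 * E + 11 = E + E + 11 by ring, pow_add, pow_add]
    norm_num; ring
  have hsq : 1 ≤ 2 ^ E * 2 ^ E := Nat.one_le_iff_ne_zero.2 (by positivity)
  rw [hpow]
  unfold bigPot at hle
  have : (8 * 2 ^ E) * (16 * 2 ^ E) = 128 * (2 ^ E * 2 ^ E) := by ring
  rw [this] at hAB
  omega

/-- The root record is well formed. [cite: HomerSelman2011, Thm. 5.13 (proof, p. 97: "The initial call")] -/
theorem wf_root (w : List Bool) :
    K.WF w.length (fstF w) ⟨0, bitsToNat (sndF w), 0, 0, 0, 0, 0, 0, 0, 0, 0, 0, 0⟩ := by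
  have hparts := length_boolUnpair_parts_le w
  have hfst : (fstF w).length ≤ w.length := by change (boolUnpair w).1.length ≤ _; omega
  have hsnd : (sndF w).length ≤ w.length := by change (boolUnpair w).2.length ≤ _; omega
  have hi : bitsToNat (sndF w) ≤ K.regBound w.length := by
    have h1 := bitsToNat_lt (sndF w)
    have h2 : 2 ^ (sndF w).length ≤ 2 ^ w.length := Nat.pow_le_pow_right (by norm_num) hsnd
    exact (le_of_lt h1).trans (h2.trans (Nat.le_add_right _ _))
  norm_num [WF, PcOK]
  exact ⟨hfst, hi⟩

/-- The root record's code. [cite: HomerSelman2011, Thm. 5.13 (proof, p. 97: "The initial call")] -/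
theorem init_eq_frameE (w : List Bool) :
    K.evalProc.init w = frameE (fstF w, (⟨0, bitsToNat (sndF w), 0, 0, 0, 0, 0, 0, 0, 0, 0, 0, 0⟩ : Regs).toList) := by
  rw [init_eq]; rfl

/-- **The certificate of the evaluator**: invariant = codes of well-formed records, rank = depth of
the gate (`≤ dpoly`), potential = loop measure (`< 2^{2(X+H)+11}`), sizes `≤ 28X + 26H + 184`.
Hence (by `RecursiveOrbitDeciders.lean`) the evaluator halts within `2^{poly}` steps in polynomial
space on every query. [cite: HomerSelman2011, Thm. 5.13 (proof, p. 97)] [cite: KoiranPerifel2009VPSPACE, §3.2, Prop. 1] -/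
def cert : K.evalProc.Cert where
  Inv := K.Inv
  rk := fun _ f => K.rkF f
  pot := fun _ f => K.potW f
  d := K.dpoly
  r := K.potPoly
  S := K.sizePoly
  init_inv := fun w => ⟨fstF w, _, K.init_eq_frameE w, K.wf_root w⟩
  init_rk := fun w => by
    rw [K.init_eq_frameE w, rkF_frameE]
    have hparts := length_boolUnpair_parts_le w
    have hfst : (fstF w).length ≤ w.length := by change (boolUnpair w).1.length ≤ _; omega
    exact (K.depth_le _).trans (TM2Iter.eval_mono _ hfst)
  size_le := by
    rintro w f ⟨g, ρ, rfl, hW⟩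
    exact K.length_frameE_le hW
  pot_lt := by
    rintro w f ⟨g, ρ, rfl, hW⟩
    rw [potW_frameE]
    exact K.potF_lt hW
  cont := by
    rintro w f ⟨g, ρ, rfl, hW⟩ h0 h1
    rw [step_frameE] at h0 h1 ⊢
    rcases K.wf_progress hW with ⟨ρ', hs, hW', hlt⟩ | ⟨k, t, -, hs, -⟩ | ⟨bit, hs⟩
    · rw [hs] at h0 h1 ⊢
      refine ⟨⟨g, ρ', rfl, hW'⟩, ?_, ?_⟩
      · change K.potW (frameE (g, ρ'.toList)) < K.potW (frameE (g, ρ.toList))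
        rw [potW_frameE, potW_frameE]; exact hlt
      · change K.rkF (frameE (g, ρ'.toList)) ≤ K.rkF (frameE (g, ρ.toList))
        rw [rkF_frameE, rkF_frameE]
    · rw [hs] at h1; exact absurd h1 (by simp [actE])
    · rw [hs] at h0; exact absurd h0 (by simp [actE])
  call := by
    rintro w f ⟨g, ρ, rfl, hW⟩ h0 h1
    rw [step_frameE] at h0 h1 ⊢
    rcases K.wf_progress hW with ⟨ρ', hs, -, -⟩ | ⟨k, t, hk, hs, ht, -⟩ | ⟨bit, hs⟩
    · rw [hs] at h1; exact absurd h1 (by simp [actE])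
    · rw [hs]
      refine ⟨⟨K.child g k, ⟨0, t, 0, 0, 0, 0, 0, 0, 0, 0, 0, 0, 0⟩, rfl, ?_⟩, ?_⟩
      · have hg : (K.child g k).length ≤ w.length := (K.length_child g k hk).trans hW.1
        norm_num [WF, PcOK]
        exact ⟨hg, ht⟩
      · change K.rkF (frameE (K.child g k, initRegs t)) < K.rkF (frameE (g, ρ.toList))
        rw [rkF_frameE, rkF_frameE]
        exact K.depth_child g k hk
    · rw [hs] at h0; exact absurd h0 (by simp [actE])
  ret := by
    rintro w f ⟨g, ρ, rfl, hW⟩ h0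
    rw [step_frameE] at h0 ⊢
    rcases K.wf_progress hW with ⟨ρ', hs, -, -⟩ | ⟨k, t, -, hs, -⟩ | ⟨bit, hs⟩
    · rw [hs] at h0; exact absurd h0 (by simp [actE])
    · rw [hs] at h0; exact absurd h0 (by simp [actE])
    · rw [hs, sizePoly, eval_add, eval_C]
      simp only [actE, List.drop_succ_cons, List.drop_zero, List.length_singleton]
      omega
  res := by
    rintro w f f' ⟨g, ρ, rfl, hW⟩ h0 h1 - -
    rw [step_frameE] at h0 h1
    rw [resume_frameE, resumeSem_toList]
    rcases K.wf_progress hW with ⟨ρ', hs, -, -⟩ | ⟨k, t, -, hs, -, hres⟩ | ⟨bit, hs⟩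
    · rw [hs] at h1; exact absurd h1 (by simp [actE])
    · obtain ⟨hW', hlt⟩ := hres (((K.evalProc.step f').drop 1).getD 0 false)
      refine ⟨⟨g, _, rfl, hW'⟩, ?_, ?_⟩
      · rw [potW_frameE, potW_frameE]; exact hlt
      · rw [rkF_frameE, rkF_frameE]
    · rw [hs] at h0; exact absurd h0 (by simp [actE])

/-- **The evaluator halts in polynomial space; its language is whatever its returned bit says.**
If the first bit of the value returned by the root record of every query `w` tells membership in
`L`, then `L ∈ PSPACE`. (The semantic file shows this bit is bit `i` of `val g` for `w = ⟨g, i⟩`,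
whence `bitLang K ∈ PSPACE`.) [cite: HomerSelman2011, Thm. 5.13 (proof, p. 97)] [cite: KoiranPerifel2009VPSPACE, §3.2, Prop. 1] -/
theorem mem_PSPACE_of_returns {L : Language Bool}
    (hL : ∀ w v, K.evalProc.Returns (K.evalProc.init w) v → (w ∈ L ↔ v.getD 0 false = true)) : L ∈ PSPACE :=
  K.cert.mem_PSPACE_of_returns hL

end Certificate

end SuccCircuit

end Literature.Computability.Complexity
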